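import Summits.NavierStokesRegularity.NavierStokesRegularity.Theorems.FilamentSkeletonRssCoreLinearInvertibilityModuloMaekawa
import Summits.NavierStokesRegularity.NavierStokesRegularity.Theorems.FilamentSkeletonRssCoreLinearInvertibilityEvenSymmetrizerBounds
import Summits.NavierStokesRegularity.NavierStokesRegularity.Theorems.FilamentSkeletonRssCoreLinearInvertibilityEvenArnold
import Summits.NavierStokesRegularity.NavierStokesRegularity.Theorems.FilamentSkeletonRssCoreLinearInvertibilityEvenFluctuationAttenuation
import Summits.NavierStokesRegularity.NavierStokesRegularity.Theorems.FilamentSkeletonRssCoreLinearInvertibilityRadialBlockToolsA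

/-!
# Route FilamentSkeletonRss · crux `CoreLinearInvertibility` (stmt-NavierStokesRegularity-17973) — line `even-volterra` (strategist s1)

An ALTERNATIVE LINE for the one remaining open stub of the live skeleton `Lines/Sketch.lean`, the even
sector `stub_maekawa2009Even : Maekawa2009_evenSectorInverseBound` (Maekawa, M3AS 19 (2009), Lemma 4.1), i.e.
for the R-sided even bound it feeds (`coreBoundEven`).  It never touches the live skeleton or its stubs; it
USES the landed even-sector blocks of the lead's chain B (`stub_evenSymmetrizerBounds` p169564,
`stub_evenSymmetrizerBoundedBelow` p169885, `stub_evenFluctuationAttenuation` 2026-08-17) and differs from chain B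
at exactly one step, the RADIAL step:

* chain B (lead, `EvenSectorAnalysis.md`): radial bound from the integrated flux with the strain source
  `‖w₀‖ ≤ C(‖f₀‖ + λ‖ |x| w_⊥ ‖)`, hence a WEIGHTED fluctuation attenuation is still to be proved;
* this line: the outward Volterra map `(Vg)(r) = e^{-r²/4} ∫₀ʳ e^{s²/4} g(s) ds` applied to the strain source
  `(λ/4) r a₂(r)` GAINS the factor `1/r` (Schur test, kernel `e^{-(1+λ)(r²-s²)/8} (rs)^{1/2}`, rows `≤ 8/(1+λ)`,
  columns `≤ 4/(1+λ)`), so `‖w₀‖_{X_λ} ≤ C_r (‖T w‖_{X_λ} + λ ‖w_⊥‖_{X_λ})` with the PLAIN norm of the fluctuation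
  `w_⊥ = w − w₀` (`stub_volterraProfileBound`, one real variable; `stub_evenPolarReduction`, the polar bookkeeping
  `P₀(T_{λ,α} w) = L w₀ + λ P₀ M w_⊥`, `P₀ M w_⊥ = (r² a₂)'/(4r)`, `P₀ Λ_G = 0`).  With it the even sector closes by
  real algebra from the LANDED unweighted fluctuation attenuation (P1), the symmetrizer bounds (B1) and Arnold (B2):
  `V ≤ ε²(‖Hv‖² + ‖v‖²)`, `‖Hv‖ ≤ ‖Tw‖ + C₁‖w_⊥‖`, `‖w_⊥‖ ≤ C_V √V`, `‖w₀‖² ≤ C_r²(‖Tw‖² + λ²‖w_⊥‖²)`,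
  `‖v‖² = ‖w₀‖² + V`, choose `ε = 1/M`, `M = 2(3 + C_r² + (2C₁² + C_r²)C_V²)` ⇒ `V ≤ ‖Tw‖²` ⇒
  `‖w‖² ≤ (C_r²(1 + C_V²) + C_V²) ‖Tw‖²` (`evenBound_of_stubs`), and the crux follows by the lead's composition
  (class closure + parity + odd sector, all landed; copied verbatim below with attribution).

Registered stubs (sorries ONLY here): `stub_evenRadialSplit` (circular-mean split toolkit of an even `C²_c`
vorticity), `stub_evenPolarReduction` (2D → radial profiles `W, A, F, J` with the flux ODE and the norm links).
The line's NEW ESTIMATE, the one-variable Volterra–Hardy inequality `volterraProfileBound` (formerly stub S2b), is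
PROVED in this file (sorry-free, `K = 10⁴`; energy form of the outward Volterra reconstruction).  Honours
`crux_false_without_massZero` (Disproof.lean): mass zero is consumed in `volterraProfileBound` (`radial_mass_pinning`).
-/

set_option linter.dupNamespace false

noncomputable section

namespace Summit.NavierStokesRegularity.NavierStokesRegularity.Cruxes.CoreLinearInvertibility.EvenVolterra

open Set Function Filter MeasureTheory Topology
open Literature.Analysis.FluidPDE
open Summit.NavierStokesRegularity.NavierStokesRegularity.Theorems
open scoped InnerProductSpace Laplacian ContDiff

/-- **Stub S1 (circular-mean split toolkit).** For an even `C²` compactly supported `w` on `ℝ²` and its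
circular mean `w₀(ξ) = (2π)⁻¹ ∫₀^{2π} w(cos t·ξ + sin t·ξ^⊥) dt`: `w₀` is `C²`, compactly supported, radial, with the
same mass; the fluctuation `w − w₀` is compactly supported, even, with vanishing circular means; the radial part plus a
Gaussian-class function is of Gaussian class; the circular mean of `w + g` is `w₀` for every continuous `g` with
vanishing circular means, and `w₀ ⊥ (w − w₀ + g)` in every `X_λ`; the local operator `L_λ − R v^G·∇` splits
additively off the radial part (`v^G·∇w₀ = 0`) and `T_{λ,R} w = L_λ w₀ + T_{λ,R}(w − w₀)` (`Λ_G w₀ = 0`). [folklore] -/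
theorem stub_evenRadialSplit :
    ∀ (w w₀ : EuclideanSpace ℝ (Fin 2) → ℝ), ContDiff ℝ 2 w → HasCompactSupport w → (∀ x, w (-x) = w x) →
    (w₀ = fun ξ => (2 * Real.pi)⁻¹ * ∫ t in (0:ℝ)..2 * Real.pi, w (Real.cos t • ξ + Real.sin t • perp ξ)) →
    -- (a) the radial part
    (ContDiff ℝ 2 w₀ ∧ HasCompactSupport w₀ ∧
      (∀ x y : EuclideanSpace ℝ (Fin 2), ‖x‖ = ‖y‖ → w₀ x = w₀ y) ∧ ∫ x, w₀ x = ∫ x, w x) ∧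
    -- (b) the fluctuation
    (HasCompactSupport (fun x => w x - w₀ x) ∧ (∀ x, w (-x) - w₀ (-x) = w x - w₀ x) ∧
      ∀ r : ℝ, 0 < r → ∫ θ in (-Real.pi)..Real.pi, (w (circlePt r θ) - w₀ (circlePt r θ)) = 0) ∧
    -- (c) Gaussian class of `w₀ + g`
    (∀ g : EuclideanSpace ℝ (Fin 2) → ℝ, ContDiff ℝ 2 g →
      (∃ (C : ℝ) (N : ℕ), ∀ x : EuclideanSpace ℝ (Fin 2),
        |g x| ≤ C * (1 + ‖x‖) ^ N * Real.exp (-(‖x‖ ^ 2 / 4)) ∧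
        ‖fderiv ℝ g x‖ ≤ C * (1 + ‖x‖) ^ N * Real.exp (-(‖x‖ ^ 2 / 4)) ∧
        ‖fderiv ℝ (fderiv ℝ g) x‖ ≤ C * (1 + ‖x‖) ^ N * Real.exp (-(‖x‖ ^ 2 / 4))) →
      ∃ (C : ℝ) (N : ℕ), ∀ x : EuclideanSpace ℝ (Fin 2),
        |(fun y => w₀ y + g y) x| ≤ C * (1 + ‖x‖) ^ N * Real.exp (-(‖x‖ ^ 2 / 4)) ∧
        ‖fderiv ℝ (fun y => w₀ y + g y) x‖ ≤ C * (1 + ‖x‖) ^ N * Real.exp (-(‖x‖ ^ 2 / 4)) ∧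
        ‖fderiv ℝ (fderiv ℝ (fun y => w₀ y + g y)) x‖ ≤ C * (1 + ‖x‖) ^ N * Real.exp (-(‖x‖ ^ 2 / 4))) ∧
    -- (d) averaging: the circular mean of `w + g` is `w₀`
    (∀ g : EuclideanSpace ℝ (Fin 2) → ℝ, Continuous g →
      (∀ r : ℝ, 0 < r → ∫ θ in (-Real.pi)..Real.pi, g (circlePt r θ) = 0) →
      (fun ξ => (2 * Real.pi)⁻¹ * ∫ t in (0:ℝ)..2 * Real.pi,
        (w (Real.cos t • ξ + Real.sin t • perp ξ) + g (Real.cos t • ξ + Real.sin t • perp ξ))) = w₀) ∧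
    -- (e) orthogonality in `X_λ`
    (∀ lam : ℝ, lam < 1 →
      Integrable (fun x => (gaussWeightLam lam x)⁻¹ * w₀ x ^ 2) ∧
      Integrable (fun x => (gaussWeightLam lam x)⁻¹ * (w x - w₀ x) ^ 2) ∧
      ∫ x, (gaussWeightLam lam x)⁻¹ * w x ^ 2 =
        (∫ x, (gaussWeightLam lam x)⁻¹ * w₀ x ^ 2) + ∫ x, (gaussWeightLam lam x)⁻¹ * (w x - w₀ x) ^ 2 ∧
      ∀ g : EuclideanSpace ℝ (Fin 2) → ℝ, Continuous g →
        (∀ r : ℝ, 0 < r → ∫ θ in (-Real.pi)..Real.pi, g (circlePt r θ) = 0) →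
        Integrable (fun x => (gaussWeightLam lam x)⁻¹ * (w x - w₀ x + g x) ^ 2) →
        ∫ x, (gaussWeightLam lam x)⁻¹ * (w x + g x) ^ 2 =
          (∫ x, (gaussWeightLam lam x)⁻¹ * w₀ x ^ 2) +
            ∫ x, (gaussWeightLam lam x)⁻¹ * (w x - w₀ x + g x) ^ 2) ∧
    -- (f) operator split off the radial part
    (∀ g : EuclideanSpace ℝ (Fin 2) → ℝ, ContDiff ℝ 2 g → ∀ (lam R : ℝ) (x : EuclideanSpace ℝ (Fin 2)),
      strainedVorticityOperator lam (fun y => w₀ y + g y) x -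
          R * ⟪gaussVortexVelocity x, gradient (fun y => w₀ y + g y) x⟫_ℝ =
        strainedVorticityOperator lam w₀ x +
          (strainedVorticityOperator lam g x - R * ⟪gaussVortexVelocity x, gradient g x⟫_ℝ)) ∧
    (∀ (lam R : ℝ) (x : EuclideanSpace ℝ (Fin 2)),
      strainedVorticityOperator lam w x -
          R * (⟪gaussVortexVelocity x, gradient w x⟫_ℝ +
            ⟪biotSavart2D w x, gradient gaussVortexProfile x⟫_ℝ) =
        strainedVorticityOperator lam w₀ x +
          (strainedVorticityOperator lam (fun y => w y - w₀ y) x -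
            R * (⟪gaussVortexVelocity x, gradient (fun y => w y - w₀ y) x⟫_ℝ +
              ⟪biotSavart2D (fun y => w y - w₀ y) x, gradient gaussVortexProfile x⟫_ℝ))) := by
  sorry

/-- **Stub S2a (polar reduction of the even radial block with its strain source).** For `λ ∈ [0,1)`, any
circulation `α`, and an even `C²_c` mass-zero `w` with circular mean `w₀`: there are a radius `b ≥ 4` containing the
support and one-variable profiles — `W(r) = w₀(r e₀)` with derivative `W₁`, the `cos 2θ`-coefficient
`A(r) = π⁻¹ ∫_{-π}^{π} (w − w₀)(circlePt r θ) cos 2θ dθ` of the fluctuation, the circular mean `F` of `T_{λ,α} w`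
(`= P₀ L_λ w`, since `P₀ Λ_G = 0`: `v^G·∇ = Ω∂_θ` and `∮ (K∗w)·x = 0`, tree `integral_inner_biotSavart2D_circlePt`), and
the flux `J = r W₁ + (r²/2) W + (λ/4) r² A` — with the flux ODE `J' = r F` on `[0,b]` (`r L w₀ = (rW' + r²W/2)'`,
`P₀ M w₀ = 0`, `P₀ M (w − w₀) = (r²A)'/(4r)` for `M = ½(x₀∂₀ − x₁∂₁) = ½(r cos 2θ ∂_r − sin 2θ ∂_θ)`), the vanishing
of `W, W₁, A` at `b`, mass zero `∫₀ᵇ W r dr = 0`, and the three norm links to `X_λ` (polar coordinates, Jensen /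
Bessel on circles; `G_λ⁻¹ = 4π/(1−λ) e^{(1−λ)|x|²/4}`). [folklore] -/
theorem stub_evenPolarReduction :
    ∀ lam ∈ Set.Ico (0 : ℝ) 1, ∀ (α : ℝ) (w w₀ : EuclideanSpace ℝ (Fin 2) → ℝ),
    ContDiff ℝ 2 w → HasCompactSupport w → (∀ x, w (-x) = w x) → ∫ x, w x = 0 →
    (w₀ = fun ξ => (2 * Real.pi)⁻¹ * ∫ t in (0:ℝ)..2 * Real.pi, w (Real.cos t • ξ + Real.sin t • perp ξ)) →
    ∃ (b : ℝ) (W W₁ A F J : ℝ → ℝ), 4 ≤ b ∧ (∀ r, HasDerivAt W (W₁ r) r) ∧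
      Continuous W₁ ∧ Continuous A ∧ Continuous F ∧
      (∀ r, J r = r * W₁ r + r ^ 2 / 2 * W r + lam / 4 * (r ^ 2 * A r)) ∧
      (∀ r ∈ Set.Icc 0 b, HasDerivAt J (r * F r) r) ∧ W b = 0 ∧ W₁ b = 0 ∧ A b = 0 ∧
      (∫ r in (0:ℝ)..b, W r * r = 0) ∧
      (∫ x, (gaussWeightLam lam x)⁻¹ * w₀ x ^ 2 ≤
        8 * Real.pi ^ 2 / (1 - lam) * ∫ r in (0:ℝ)..b, Real.exp ((1 - lam) / 4 * r ^ 2) * W r ^ 2 * r) ∧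
      (8 * Real.pi ^ 2 / (1 - lam) * ∫ r in (0:ℝ)..b, Real.exp ((1 - lam) / 4 * r ^ 2) * F r ^ 2 * r ≤
        ∫ x, (gaussWeightLam lam x)⁻¹ * (strainedVorticityOperator lam w x -
          α * (⟪gaussVortexVelocity x, gradient w x⟫_ℝ +
            ⟪biotSavart2D w x, gradient gaussVortexProfile x⟫_ℝ)) ^ 2) ∧
      (4 * Real.pi ^ 2 / (1 - lam) * ∫ r in (0:ℝ)..b, Real.exp ((1 - lam) / 4 * r ^ 2) * A r ^ 2 * r ≤
        ∫ x, (gaussWeightLam lam x)⁻¹ * (w x - w₀ x) ^ 2) := by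
  sorry

/-! ### S2b — the one-variable Volterra–Hardy bound, PROVED (sorry-free): weighted energy identity of the outward
Volterra reconstruction, mass-zero pinning, centre sup bound, weighted Cauchy–Schwarz, scalar endgame. -/

/-- **Weighted energy identity for `P' + (r/2)P = S`.** For `P ∈ C¹` and `β, b` real (`0 ≤ b`):
`e^{βb²/4} P(b)² − P(0)² + (2−β)/2 ∫₀ᵇ e^{βr²/4} P² r dr = 2 ∫₀ᵇ e^{βr²/4} P (P' + (r/2) P) dr`
(FTC for `e^{βr²/4} P²`).  With `S := P' + (r/2)P` this is the `L²(e^{βr²/4} r dr)` energy estimate of the outward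
Volterra reconstruction: the coercive term carries the factor `r`. [folklore] -/
theorem ode_weighted_energy_eq {β b : ℝ} {P P₁ : ℝ → ℝ}
    (hP : ∀ r, HasDerivAt P (P₁ r) r) (hP₁c : Continuous P₁) :
    Real.exp (β / 4 * b ^ 2) * P b ^ 2 - P 0 ^ 2 +
      (2 - β) / 2 * ∫ r in (0:ℝ)..b, Real.exp (β / 4 * r ^ 2) * P r ^ 2 * r =
      2 * ∫ r in (0:ℝ)..b, Real.exp (β / 4 * r ^ 2) * P r * (P₁ r + r / 2 * P r) := by
  have hPc : Continuous P := continuous_iff_continuousAt.2 fun r => (hP r).continuousAt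
  have hEc : Continuous fun r : ℝ => Real.exp (β / 4 * r ^ 2) :=
    Real.continuous_exp.comp (continuous_const.mul (continuous_id.pow 2))
  have hf : ∀ r ∈ uIcc 0 b, HasDerivAt (fun s => Real.exp (β / 4 * s ^ 2) * P s ^ 2)
      (2 * (β / 4) * r * Real.exp (β / 4 * r ^ 2) * P r ^ 2 +
        Real.exp (β / 4 * r ^ 2) * (2 * P r * P₁ r)) r := by
    intro r _
    have h1 := hasDerivAt_exp_mul_sq (β / 4) r
    have h2 : HasDerivAt (fun s => P s ^ 2) (2 * P r * P₁ r) r := by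
      simpa using (hP r).fun_pow 2
    exact h1.mul h2
  have hc1 : Continuous fun r => 2 * (β / 4) * r * Real.exp (β / 4 * r ^ 2) * P r ^ 2 +
      Real.exp (β / 4 * r ^ 2) * (2 * P r * P₁ r) := by
    fun_prop
  have hftc := intervalIntegral.integral_eq_sub_of_hasDerivAt hf (hc1.intervalIntegrable _ _)
  have e0 : Real.exp (β / 4 * (0:ℝ) ^ 2) * P 0 ^ 2 = P 0 ^ 2 := by simp
  have hc2 : Continuous fun r => Real.exp (β / 4 * r ^ 2) * P r ^ 2 * r := by fun_prop
  have hc3 : Continuous fun r => Real.exp (β / 4 * r ^ 2) * P r * (P₁ r + r / 2 * P r) := by fun_prop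
  have key : (∫ r in (0:ℝ)..b, (2 * (β / 4) * r * Real.exp (β / 4 * r ^ 2) * P r ^ 2 +
        Real.exp (β / 4 * r ^ 2) * (2 * P r * P₁ r))) +
      (2 - β) / 2 * ∫ r in (0:ℝ)..b, Real.exp (β / 4 * r ^ 2) * P r ^ 2 * r =
      2 * ∫ r in (0:ℝ)..b, Real.exp (β / 4 * r ^ 2) * P r * (P₁ r + r / 2 * P r) := by
    rw [← intervalIntegral.integral_const_mul, ← intervalIntegral.integral_const_mul,
      ← intervalIntegral.integral_add (hc1.intervalIntegrable _ _)
        ((hc2.intervalIntegrable _ _).const_mul _)]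
    refine intervalIntegral.integral_congr fun r _ => ?_
    ring
  rw [e0] at hftc
  linarith [hftc, key]

/-- **Energy inequality** (`P(0) = 0`, `β ≤ 2`, boundary term dropped):
`(2−β)/4 ‖P‖²_β ≤ ∫₀ᵇ e^{βr²/4} P (P' + (r/2)P) dr`. [folklore] -/
theorem ode_weighted_energy_le {β b : ℝ} {P P₁ : ℝ → ℝ}
    (hP : ∀ r, HasDerivAt P (P₁ r) r) (hP₁c : Continuous P₁) (hP0 : P 0 = 0) :
    (2 - β) / 4 * ∫ r in (0:ℝ)..b, Real.exp (β / 4 * r ^ 2) * P r ^ 2 * r ≤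
      ∫ r in (0:ℝ)..b, Real.exp (β / 4 * r ^ 2) * P r * (P₁ r + r / 2 * P r) := by
  have h := ode_weighted_energy_eq (β := β) (b := b) hP hP₁c
  rw [hP0] at h
  have hbd : 0 ≤ Real.exp (β / 4 * b ^ 2) * P b ^ 2 := by positivity
  nlinarith [h, hbd]

/-- `∫₀ᵇ e^{-a r²} r dr = (1 − e^{-a b²})/(2a)` for `a ≠ 0`. [folklore] -/
theorem integral_mul_exp_neg_sq {a b : ℝ} (ha : a ≠ 0) :
    ∫ r in (0:ℝ)..b, Real.exp (-a * r ^ 2) * r = (1 - Real.exp (-a * b ^ 2)) / (2 * a) := by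
  have hderiv : ∀ r ∈ uIcc 0 b, HasDerivAt (fun s => -(1 / (2 * a)) * Real.exp (-a * s ^ 2))
      (Real.exp (-a * r ^ 2) * r) r := by
    intro r _
    have h := (hasDerivAt_exp_mul_sq (-a) r).const_mul (-(1 / (2 * a)))
    refine h.congr_deriv ?_
    field_simp
  have hc : Continuous fun r : ℝ => Real.exp (-a * r ^ 2) * r := by fun_prop
  rw [intervalIntegral.integral_eq_sub_of_hasDerivAt hderiv (hc.intervalIntegrable _ _)]
  simp only [ne_eq, OfNat.ofNat_ne_zero, not_false_eq_true, zero_pow, mul_zero, Real.exp_zero, mul_one]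
  field_simp
  ring

/-- **Mass-zero pinning of the homogeneous mode.** If `W = W₀ e^{-r²/4} + P` on `ℝ` with `P` continuous,
`∫₀ᵇ W r dr = 0`, `b ≥ 4` and `0 < β ≤ 1`, then `‖W‖²_β ≤ (10/β) ‖P‖²_β`
(`‖g‖²_β = ∫₀ᵇ e^{βr²/4} g² r dr`): the mass condition gives `W₀ ∫₀ᵇ e^{-r²/4} r = −∫₀ᵇ P r`,
`∫₀ᵇ e^{-r²/4} r ≥ 2(1 − e^{-4}) ≥ 8/5 ≥ 1`, Cauchy–Schwarz `(∫₀ᵇ P r)² ≤ (2/β) ‖P‖²_β`, `‖e^{-r²/4}‖²_β ≤ 2`,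
so `‖W‖²_β ≤ 4W₀² + 2‖P‖²_β ≤ (8/β + 2)‖P‖²_β ≤ (10/β)‖P‖²_β`. [folklore] -/
theorem radial_mass_pinning {β b W₀ : ℝ} (hβ : 0 < β) (hβ1 : β ≤ 1) (hb : 4 ≤ b) {W P : ℝ → ℝ}
    (hPc : Continuous P) (hWP : ∀ r, W r = W₀ * Real.exp (-(r ^ 2 / 4)) + P r)
    (hmass : ∫ r in (0:ℝ)..b, W r * r = 0) :
    ∫ r in (0:ℝ)..b, Real.exp (β / 4 * r ^ 2) * W r ^ 2 * r ≤
      10 / β * ∫ r in (0:ℝ)..b, Real.exp (β / 4 * r ^ 2) * P r ^ 2 * r := by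
  have hb0 : (0:ℝ) ≤ b := by linarith
  have hβ0 : β ≠ 0 := hβ.ne'
  set NP := ∫ r in (0:ℝ)..b, Real.exp (β / 4 * r ^ 2) * P r ^ 2 * r with hNP
  have hEc : ∀ c : ℝ, Continuous fun r : ℝ => Real.exp (c * r ^ 2) := fun c =>
    Real.continuous_exp.comp (continuous_const.mul (continuous_id.pow 2))
  have hNP0 : 0 ≤ NP := intervalIntegral.integral_nonneg hb0 fun r hr => by
    have := hr.1; positivity
  -- the Gaussian mass integral `I₀ = ∫₀ᵇ e^{-r²/4} r ≥ 8/5`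
  have hI₀ : ∫ r in (0:ℝ)..b, Real.exp (-(1 / 4) * r ^ 2) * r = (1 - Real.exp (-(1 / 4) * b ^ 2)) / (2 * (1 / 4)) :=
    integral_mul_exp_neg_sq (by norm_num)
  have hI₀ge : (8:ℝ) / 5 ≤ ∫ r in (0:ℝ)..b, Real.exp (-(1 / 4) * r ^ 2) * r := by
    rw [hI₀]
    have h4 : Real.exp (-(1 / 4) * b ^ 2) ≤ Real.exp (-4) := by
      apply Real.exp_le_exp.2
      nlinarith
    have he4 : Real.exp (-4) ≤ 1 / 5 := by
      have h := Real.add_one_le_exp (4:ℝ)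
      have hpos := Real.exp_pos (4:ℝ)
      rw [Real.exp_neg]
      rw [inv_le_comm₀ hpos (by norm_num)]
      linarith
    have : (1 - Real.exp (-(1 / 4) * b ^ 2)) / (2 * (1 / 4)) = 2 * (1 - Real.exp (-(1 / 4) * b ^ 2)) := by ring
    rw [this]
    linarith
  -- mass zero: `W₀ I₀ = -∫ P r`
  have hPi : IntervalIntegrable (fun r => P r * r) volume 0 b := (hPc.mul continuous_id).intervalIntegrable _ _
  have hGi : IntervalIntegrable (fun r => W₀ * (Real.exp (-(1 / 4) * r ^ 2) * r)) volume 0 b :=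
    ((hEc _).mul continuous_id).intervalIntegrable _ _ |>.const_mul _
  have hsplit : ∫ r in (0:ℝ)..b, W r * r =
      W₀ * (∫ r in (0:ℝ)..b, Real.exp (-(1 / 4) * r ^ 2) * r) + ∫ r in (0:ℝ)..b, P r * r := by
    rw [← intervalIntegral.integral_const_mul, ← intervalIntegral.integral_add hGi hPi]
    refine intervalIntegral.integral_congr fun r _ => ?_
    simp only [hWP r]
    have : Real.exp (-(r ^ 2 / 4)) = Real.exp (-(1 / 4) * r ^ 2) := by congr 1; ring
    rw [this]; ring
  rw [hsplit] at hmass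
  -- Cauchy–Schwarz: `(∫ P r)² ≤ (∫ e^{-βr²/4} r)(∫ e^{βr²/4} P² r) ≤ (2/β) NP`
  have hCS : (∫ r in (0:ℝ)..b, P r * r) ^ 2 ≤ 2 / β * NP := by
    have hf2 : IntervalIntegrable (fun r => (Real.exp (-(β / 8) * r ^ 2) * Real.sqrt r) ^ 2) volume 0 b :=
      (((hEc _).mul Real.continuous_sqrt).pow 2).intervalIntegrable _ _
    have hg2 : IntervalIntegrable (fun r => (Real.exp (β / 8 * r ^ 2) * Real.sqrt r * P r) ^ 2) volume 0 b :=
      ((((hEc _).mul Real.continuous_sqrt).mul hPc).pow 2).intervalIntegrable _ _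
    have hfg : IntervalIntegrable (fun r => (Real.exp (-(β / 8) * r ^ 2) * Real.sqrt r) *
        (Real.exp (β / 8 * r ^ 2) * Real.sqrt r * P r)) volume 0 b :=
      (((hEc _).mul Real.continuous_sqrt).mul (((hEc _).mul Real.continuous_sqrt).mul hPc)).intervalIntegrable _ _
    have key := sq_intervalIntegral_mul_le hb0 hf2 hg2 hfg
    have e1 : ∫ r in (0:ℝ)..b, (Real.exp (-(β / 8) * r ^ 2) * Real.sqrt r) *
        (Real.exp (β / 8 * r ^ 2) * Real.sqrt r * P r) = ∫ r in (0:ℝ)..b, P r * r := by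
      refine intervalIntegral.integral_congr fun r hr => ?_
      rw [uIcc_of_le hb0] at hr
      have hs : Real.sqrt r * Real.sqrt r = r := Real.mul_self_sqrt hr.1
      have hee : Real.exp (-(β / 8) * r ^ 2) * Real.exp (β / 8 * r ^ 2) = 1 := by
        rw [← Real.exp_add]; simp
      calc Real.exp (-(β / 8) * r ^ 2) * Real.sqrt r * (Real.exp (β / 8 * r ^ 2) * Real.sqrt r * P r)
          = (Real.exp (-(β / 8) * r ^ 2) * Real.exp (β / 8 * r ^ 2)) * (Real.sqrt r * Real.sqrt r) * P r := by
            ring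
        _ = P r * r := by rw [hee, hs]; ring
    have e2 : ∫ r in (0:ℝ)..b, (Real.exp (-(β / 8) * r ^ 2) * Real.sqrt r) ^ 2 =
        ∫ r in (0:ℝ)..b, Real.exp (-(β / 4) * r ^ 2) * r := by
      refine intervalIntegral.integral_congr fun r hr => ?_
      rw [uIcc_of_le hb0] at hr
      have hs : Real.sqrt r ^ 2 = r := Real.sq_sqrt hr.1
      have hee : Real.exp (-(β / 8) * r ^ 2) ^ 2 = Real.exp (-(β / 4) * r ^ 2) := by
        rw [← Real.exp_nat_mul]; congr 1; push_cast; ring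
      rw [mul_pow, hs, hee]
    have e3 : ∫ r in (0:ℝ)..b, (Real.exp (β / 8 * r ^ 2) * Real.sqrt r * P r) ^ 2 = NP := by
      rw [hNP]
      refine intervalIntegral.integral_congr fun r hr => ?_
      rw [uIcc_of_le hb0] at hr
      have hs : Real.sqrt r ^ 2 = r := Real.sq_sqrt hr.1
      have hee : Real.exp (β / 8 * r ^ 2) ^ 2 = Real.exp (β / 4 * r ^ 2) := by
        rw [← Real.exp_nat_mul]; congr 1; push_cast; ring
      rw [mul_pow, mul_pow, hs, hee]; ring
    rw [e1, e2, e3] at key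
    have hIβ : ∫ r in (0:ℝ)..b, Real.exp (-(β / 4) * r ^ 2) * r ≤ 2 / β := by
      rw [integral_mul_exp_neg_sq (by positivity : (β / 4 : ℝ) ≠ 0)]
      have hpos : 0 < Real.exp (-(β / 4) * b ^ 2) := Real.exp_pos _
      have : (1 - Real.exp (-(β / 4) * b ^ 2)) / (2 * (β / 4)) = 2 / β * (1 - Real.exp (-(β / 4) * b ^ 2)) := by
        field_simp; ring
      rw [this]
      have h2β : 0 < 2 / β := by positivity
      nlinarith
    calc (∫ r in (0:ℝ)..b, P r * r) ^ 2
        ≤ (∫ r in (0:ℝ)..b, Real.exp (-(β / 4) * r ^ 2) * r) * NP := key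
      _ ≤ 2 / β * NP := mul_le_mul_of_nonneg_right hIβ hNP0
  -- hence `W₀² ≤ (25/64)(2/β) NP`
  have hW0 : W₀ ^ 2 ≤ 2 / β * NP := by
    set I := ∫ r in (0:ℝ)..b, Real.exp (-(1 / 4) * r ^ 2) * r with hI
    have hWI : (W₀ * I) ^ 2 = (∫ r in (0:ℝ)..b, P r * r) ^ 2 := by
      have : W₀ * I = -∫ r in (0:ℝ)..b, P r * r := by linarith
      rw [this, neg_sq]
    have h1 : W₀ ^ 2 * I ^ 2 ≤ 2 / β * NP := by rw [← mul_pow, hWI]; exact hCS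
    have hI1 : 1 ≤ I ^ 2 := by nlinarith
    have h2 : 0 ≤ 2 / β * NP := by positivity
    nlinarith [sq_nonneg W₀, mul_le_mul_of_nonneg_left hI1 (sq_nonneg W₀)]
  -- `‖W‖² ≤ 2 ‖W₀ e^{-r²/4}‖² + 2 ‖P‖²` and `‖e^{-r²/4}‖²_β ≤ 2`
  have hG2 : ∫ r in (0:ℝ)..b, Real.exp (β / 4 * r ^ 2) * (W₀ * Real.exp (-(r ^ 2 / 4))) ^ 2 * r ≤ 2 * W₀ ^ 2 := by
    have hle : ∫ r in (0:ℝ)..b, Real.exp (β / 4 * r ^ 2) * (W₀ * Real.exp (-(r ^ 2 / 4))) ^ 2 * r ≤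
        ∫ r in (0:ℝ)..b, W₀ ^ 2 * (Real.exp (-(1 / 4) * r ^ 2) * r) := by
      refine intervalIntegral.integral_mono_on hb0 ?_ ?_ fun r hr => ?_
      · exact (((hEc _).mul ((continuous_const.mul (Real.continuous_exp.comp
          ((continuous_id.pow 2).div_const 4).neg)).pow 2)).mul continuous_id).intervalIntegrable _ _
      · exact (continuous_const.mul ((hEc _).mul continuous_id)).intervalIntegrable _ _
      · have hr0 := hr.1
        have hexp : Real.exp (β / 4 * r ^ 2) * Real.exp (-(r ^ 2 / 4)) ^ 2 ≤ Real.exp (-(1 / 4) * r ^ 2) := by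
          rw [← Real.exp_nat_mul, ← Real.exp_add]
          apply Real.exp_le_exp.2
          push_cast
          nlinarith [sq_nonneg r]
        calc Real.exp (β / 4 * r ^ 2) * (W₀ * Real.exp (-(r ^ 2 / 4))) ^ 2 * r
            = W₀ ^ 2 * ((Real.exp (β / 4 * r ^ 2) * Real.exp (-(r ^ 2 / 4)) ^ 2) * r) := by ring
          _ ≤ W₀ ^ 2 * (Real.exp (-(1 / 4) * r ^ 2) * r) :=
            mul_le_mul_of_nonneg_left (mul_le_mul_of_nonneg_right hexp hr0) (sq_nonneg _)
    rw [intervalIntegral.integral_const_mul, hI₀] at hle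
    have hexpb : 0 < Real.exp (-(1 / 4) * b ^ 2) := Real.exp_pos _
    have : (1 - Real.exp (-(1 / 4) * b ^ 2)) / (2 * (1 / 4)) ≤ 2 := by
      rw [div_le_iff₀ (by norm_num)]; linarith
    nlinarith [sq_nonneg W₀]
  have hsum : ∫ r in (0:ℝ)..b, Real.exp (β / 4 * r ^ 2) * W r ^ 2 * r ≤
      2 * (∫ r in (0:ℝ)..b, Real.exp (β / 4 * r ^ 2) * (W₀ * Real.exp (-(r ^ 2 / 4))) ^ 2 * r) + 2 * NP := by
    rw [hNP, ← intervalIntegral.integral_const_mul, ← intervalIntegral.integral_const_mul,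
      ← intervalIntegral.integral_add]
    · refine intervalIntegral.integral_mono_on hb0 ?_ ?_ fun r hr => ?_
      · have hWc : Continuous W := by
          have : W = fun r => W₀ * Real.exp (-(r ^ 2 / 4)) + P r := funext hWP
          rw [this]; fun_prop
        exact (((hEc _).mul (hWc.pow 2)).mul continuous_id).intervalIntegrable _ _
      · exact ((continuous_const.mul (((hEc _).mul ((continuous_const.mul (Real.continuous_exp.comp
          ((continuous_id.pow 2).div_const 4).neg)).pow 2)).mul continuous_id)).add
          (continuous_const.mul (((hEc _).mul (hPc.pow 2)).mul continuous_id))).intervalIntegrable _ _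
      · have hr0 := hr.1
        have he : 0 ≤ Real.exp (β / 4 * r ^ 2) * r := by positivity
        rw [hWP r]
        have hsq : (W₀ * Real.exp (-(r ^ 2 / 4)) + P r) ^ 2 ≤
            2 * (W₀ * Real.exp (-(r ^ 2 / 4))) ^ 2 + 2 * P r ^ 2 := by
          nlinarith [sq_nonneg (W₀ * Real.exp (-(r ^ 2 / 4)) - P r)]
        calc Real.exp (β / 4 * r ^ 2) * (W₀ * Real.exp (-(r ^ 2 / 4)) + P r) ^ 2 * r
            = (Real.exp (β / 4 * r ^ 2) * r) * (W₀ * Real.exp (-(r ^ 2 / 4)) + P r) ^ 2 := by ring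
          _ ≤ (Real.exp (β / 4 * r ^ 2) * r) * (2 * (W₀ * Real.exp (-(r ^ 2 / 4))) ^ 2 + 2 * P r ^ 2) :=
            mul_le_mul_of_nonneg_left hsq he
          _ = 2 * (Real.exp (β / 4 * r ^ 2) * (W₀ * Real.exp (-(r ^ 2 / 4))) ^ 2 * r) +
              2 * (Real.exp (β / 4 * r ^ 2) * P r ^ 2 * r) := by ring
    · exact (continuous_const.mul (((hEc _).mul ((continuous_const.mul (Real.continuous_exp.comp
          ((continuous_id.pow 2).div_const 4).neg)).pow 2)).mul continuous_id)).intervalIntegrable _ _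
    · exact (continuous_const.mul (((hEc _).mul (hPc.pow 2)).mul continuous_id)).intervalIntegrable _ _
  -- conclude: `‖W‖² ≤ 4 W₀² + 2 NP ≤ (8/β + 2) NP ≤ (10/β) NP`
  have h2β : 2 ≤ 2 / β := by
    rw [le_div_iff₀ hβ]; nlinarith
  have hNP2 : 2 * NP ≤ 2 / β * NP := by nlinarith [h2β, hNP0]
  have e10 : 4 * (2 / β * NP) + 2 / β * NP = 10 / β * NP := by ring
  show ∫ r in (0:ℝ)..b, Real.exp (β / 4 * r ^ 2) * W r ^ 2 * r ≤ 10 / β * NP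
  linarith [hsum, hG2, hW0, hNP2, e10]

/-- **Sup bound for the outward Volterra reconstruction near the centre.** If `P ∈ C¹`, `P(0) = 0` and
`P' + (r/2)P = q` (continuous), then `|P(r)| ≤ e^{1/4} ∫₀ʳ |q|` for `r ∈ [0,1]`
(`(e^{s²/4}P)' = e^{s²/4} q`). [folklore] -/
theorem volterra_center_abs_le {P P₁ q : ℝ → ℝ} (hP : ∀ r, HasDerivAt P (P₁ r) r)
    (hqc : Continuous q) (hq : ∀ s, P₁ s + s / 2 * P s = q s) (hP0 : P 0 = 0) {r : ℝ} (hr : r ∈ Icc (0:ℝ) 1) :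
    |P r| ≤ Real.exp (1 / 4) * ∫ s in (0:ℝ)..r, |q s| := by
  have hPc : Continuous P := continuous_iff_continuousAt.2 fun s => (hP s).continuousAt
  have hr0 : (0:ℝ) ≤ r := hr.1
  -- FTC for `E(s) = e^{s²/4} P(s)`
  have hE : ∀ s ∈ uIcc 0 r, HasDerivAt (fun t => Real.exp (1 / 4 * t ^ 2) * P t)
      (Real.exp (1 / 4 * s ^ 2) * q s) s := by
    intro s _
    have h1 := hasDerivAt_exp_mul_sq (1 / 4) s
    have h := h1.mul (hP s)
    refine h.congr_deriv ?_
    rw [← hq s]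
    ring
  have hc : Continuous fun s => Real.exp (1 / 4 * s ^ 2) * q s := by fun_prop
  have hftc := intervalIntegral.integral_eq_sub_of_hasDerivAt hE (hc.intervalIntegrable _ _)
  simp only [hP0, mul_zero] at hftc
  have hEq : Real.exp (1 / 4 * r ^ 2) * P r = ∫ s in (0:ℝ)..r, Real.exp (1 / 4 * s ^ 2) * q s := by
    rw [hftc]; simp
  -- bound the integral
  have hbound : |∫ s in (0:ℝ)..r, Real.exp (1 / 4 * s ^ 2) * q s| ≤ ∫ s in (0:ℝ)..r, Real.exp (1 / 4) * |q s| := by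
    refine (intervalIntegral.abs_integral_le_integral_abs hr0).trans ?_
    refine intervalIntegral.integral_mono_on hr0 ?_ ?_ fun s hs => ?_
    · exact (hc.abs).intervalIntegrable _ _
    · exact (continuous_const.mul hqc.abs).intervalIntegrable _ _
    · rw [abs_mul, abs_of_pos (Real.exp_pos _)]
      refine mul_le_mul_of_nonneg_right ?_ (abs_nonneg _)
      apply Real.exp_le_exp.2
      have : s ^ 2 ≤ 1 := by nlinarith [hs.1, hs.2, hr.2]
      linarith
  rw [intervalIntegral.integral_const_mul] at hbound
  have hexp1 : 1 ≤ Real.exp (1 / 4 * r ^ 2) := Real.one_le_exp (by positivity)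
  have hPle : |P r| ≤ |Real.exp (1 / 4 * r ^ 2) * P r| := by
    rw [abs_mul, abs_of_pos (Real.exp_pos _)]
    exact le_mul_of_one_le_left (abs_nonneg _) hexp1
  calc |P r| ≤ |Real.exp (1 / 4 * r ^ 2) * P r| := hPle
    _ = |∫ s in (0:ℝ)..r, Real.exp (1 / 4 * s ^ 2) * q s| := by rw [hEq]
    _ ≤ Real.exp (1 / 4) * ∫ s in (0:ℝ)..r, |q s| := hbound


/-- Weighted Cauchy–Schwarz on `[0,b]` with a nonnegative continuous weight. -/
theorem weighted_cs {b : ℝ} (hb : 0 ≤ b) {w u v : ℝ → ℝ} (hw : ∀ r ∈ Icc 0 b, 0 ≤ w r)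
    (hwc : Continuous w) (huc : Continuous u) (hvc : Continuous v) :
    (∫ r in (0:ℝ)..b, w r * u r * v r) ^ 2 ≤
      (∫ r in (0:ℝ)..b, w r * u r ^ 2) * ∫ r in (0:ℝ)..b, w r * v r ^ 2 := by
  have hsc : Continuous fun r => Real.sqrt (w r) := Real.continuous_sqrt.comp hwc
  have hf2 : IntervalIntegrable (fun r => (Real.sqrt (w r) * u r) ^ 2) volume 0 b :=
    ((hsc.mul huc).pow 2).intervalIntegrable _ _
  have hg2 : IntervalIntegrable (fun r => (Real.sqrt (w r) * v r) ^ 2) volume 0 b :=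
    ((hsc.mul hvc).pow 2).intervalIntegrable _ _
  have hfg : IntervalIntegrable (fun r => (Real.sqrt (w r) * u r) * (Real.sqrt (w r) * v r)) volume 0 b :=
    ((hsc.mul huc).mul (hsc.mul hvc)).intervalIntegrable _ _
  have key := sq_intervalIntegral_mul_le hb hf2 hg2 hfg
  have e1 : ∫ r in (0:ℝ)..b, (Real.sqrt (w r) * u r) * (Real.sqrt (w r) * v r) =
      ∫ r in (0:ℝ)..b, w r * u r * v r := by
    refine intervalIntegral.integral_congr fun r hr => ?_
    rw [uIcc_of_le hb] at hr
    have hs : Real.sqrt (w r) * Real.sqrt (w r) = w r := Real.mul_self_sqrt (hw r hr)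
    calc Real.sqrt (w r) * u r * (Real.sqrt (w r) * v r) = (Real.sqrt (w r) * Real.sqrt (w r)) * u r * v r := by ring
      _ = w r * u r * v r := by rw [hs]
  have e2 : ∫ r in (0:ℝ)..b, (Real.sqrt (w r) * u r) ^ 2 = ∫ r in (0:ℝ)..b, w r * u r ^ 2 := by
    refine intervalIntegral.integral_congr fun r hr => ?_
    rw [uIcc_of_le hb] at hr
    have hs : Real.sqrt (w r) ^ 2 = w r := Real.sq_sqrt (hw r hr)
    rw [mul_pow, hs]
  have e3 : ∫ r in (0:ℝ)..b, (Real.sqrt (w r) * v r) ^ 2 = ∫ r in (0:ℝ)..b, w r * v r ^ 2 := by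
    refine intervalIntegral.integral_congr fun r hr => ?_
    rw [uIcc_of_le hb] at hr
    have hs : Real.sqrt (w r) ^ 2 = w r := Real.sq_sqrt (hw r hr)
    rw [mul_pow, hs]
  rw [e1, e2, e3] at key
  exact key

/-- From `x² ≤ c₁ + c₂ x` with `c₁, c₂ ≥ 0` conclude `x² ≤ 2 c₁ + c₂²`. -/
theorem sq_le_of_sq_le_lin {x c₁ c₂ : ℝ} (_h1 : 0 ≤ c₁) (_h2 : 0 ≤ c₂) (h : x ^ 2 ≤ c₁ + c₂ * x) :
    x ^ 2 ≤ 2 * c₁ + c₂ ^ 2 := by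
  nlinarith [sq_nonneg (x - c₂)]

set_option maxHeartbeats 800000 in
/-- The scalar endgame of S2b. -/
theorem s2b_algebra {β t x f a m n E μ NP NF NA NW : ℝ} (hβ : 0 < β) (hβ1 : β ≤ 1) (ht : t = 1 / β)
    (_hx0 : 0 ≤ x) (hf0 : 0 ≤ f) (ha0 : 0 ≤ a) (hm0 : 0 ≤ m) (hn0 : 0 ≤ n) (_hE0 : 0 ≤ E) (hE2 : E ≤ 2)
    (hxsq : x ^ 2 = NP) (hfsq : f ^ 2 = NF) (hasq : a ^ 2 = NA) (hmsq : m ^ 2 = NF / 2) (hnsq : n ^ 2 = NA / 2)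
    (hmain : (2 - β) / 4 * NP ≤ E * (m + |μ| * n) * m + x * (4 / β * f) + |μ| * (x * a))
    (hpin : NW ≤ 10 / β * NP) :
    NW ≤ 10 ^ 4 / β ^ 3 * (NF + μ ^ 2 * NA) := by
  have ht1 : 1 ≤ t := by rw [ht]; exact (one_le_div hβ).2 hβ1
  have ht0 : 0 ≤ t := by linarith
  have e4 : 4 / β = 4 * t := by rw [ht]; ring
  have e10 : 10 / β = 10 * t := by rw [ht]; ring
  have e104 : (10:ℝ) ^ 4 / β ^ 3 = 10 ^ 4 * t ^ 3 := by rw [ht]; field_simp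
  rw [e4] at hmain
  rw [e10] at hpin
  have hNP0 : 0 ≤ NP := by rw [← hxsq]; positivity
  have hNF0 : 0 ≤ NF := by rw [← hfsq]; positivity
  have hNA0 : 0 ≤ NA := by rw [← hasq]; positivity
  have hμ0 : 0 ≤ |μ| := abs_nonneg _
  have hμNA0 : 0 ≤ μ ^ 2 * NA := by positivity
  -- S1
  have hq : NP / 4 ≤ (2 - β) / 4 * NP := by
    have h0 : 0 ≤ (1 - β) / 4 * NP := mul_nonneg (by linarith) hNP0
    have e : (2 - β) / 4 * NP = NP / 4 + (1 - β) / 4 * NP := by ring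
    linarith
  have hEm : E * (m + |μ| * n) * m ≤ 2 * m ^ 2 + 2 * (|μ| * m * n) := by
    have h0 : 0 ≤ (m + |μ| * n) * m := by positivity
    have h1 := mul_le_mul_of_nonneg_right hE2 h0
    calc E * (m + |μ| * n) * m = E * ((m + |μ| * n) * m) := by ring
      _ ≤ 2 * ((m + |μ| * n) * m) := h1
      _ = 2 * m ^ 2 + 2 * (|μ| * m * n) := by ring
  have S1 : x ^ 2 ≤ (8 * m ^ 2 + 8 * (|μ| * m * n)) + (16 * t * f + 4 * (|μ| * a)) * x := by
    rw [hxsq]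
    have : NP / 4 ≤ 2 * m ^ 2 + 2 * (|μ| * m * n) + x * (4 * t * f) + |μ| * (x * a) := by linarith
    linarith
  have hc1 : 0 ≤ 8 * m ^ 2 + 8 * (|μ| * m * n) := by positivity
  have hc2 : 0 ≤ 16 * t * f + 4 * (|μ| * a) := by positivity
  have S2 := sq_le_of_sq_le_lin hc1 hc2 S1
  -- S3
  have hmn : 2 * (|μ| * m * n) ≤ m ^ 2 + μ ^ 2 * n ^ 2 := by
    have h := sq_nonneg (m - |μ| * n)
    have e : (m - |μ| * n) ^ 2 = m ^ 2 - 2 * (|μ| * m * n) + μ ^ 2 * n ^ 2 := by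
      rw [sub_sq, mul_pow, sq_abs]; ring
    linarith
  have hfa : 2 * (|μ| * f * a) ≤ f ^ 2 + μ ^ 2 * a ^ 2 := by
    have h := sq_nonneg (f - |μ| * a)
    have e : (f - |μ| * a) ^ 2 = f ^ 2 - 2 * (|μ| * f * a) + μ ^ 2 * a ^ 2 := by
      rw [sub_sq, mul_pow, sq_abs]; ring
    linarith
  have htfa : 2 * t * (|μ| * f * a) ≤ t * (f ^ 2 + μ ^ 2 * a ^ 2) := by
    have := mul_le_mul_of_nonneg_left hfa ht0; linarith
  have hc2sq : (16 * t * f + 4 * (|μ| * a)) ^ 2 ≤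
      256 * (t ^ 2 * f ^ 2) + 64 * (t * (f ^ 2 + μ ^ 2 * a ^ 2)) + 16 * (μ ^ 2 * a ^ 2) := by
    have e : (16 * t * f + 4 * (|μ| * a)) ^ 2 =
        256 * (t ^ 2 * f ^ 2) + 64 * (2 * t * (|μ| * f * a)) + 16 * (|μ| ^ 2 * a ^ 2) := by ring
    rw [e, sq_abs]; linarith [htfa]
  have htt : t ≤ t ^ 2 := by
    have h := mul_le_mul_of_nonneg_left ht1 ht0
    rw [mul_one, ← pow_two] at h
    exact h
  have ht23 : t ^ 2 ≤ t ^ 3 := by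
    have h := mul_le_mul_of_nonneg_left ht1 (sq_nonneg t)
    rw [mul_one, ← pow_succ] at h
    exact h
  have ht2 : 1 ≤ t ^ 2 := one_le_pow₀ ht1
  have k1 : NF ≤ t ^ 2 * NF := by
    have h := mul_le_mul_of_nonneg_right ht2 hNF0; rwa [one_mul] at h
  have k2 : t * NF ≤ t ^ 2 * NF := mul_le_mul_of_nonneg_right htt hNF0
  have k3 : μ ^ 2 * NA ≤ t * (μ ^ 2 * NA) := by
    have h := mul_le_mul_of_nonneg_right ht1 hμNA0; rwa [one_mul] at h
  have k4 : t ^ 2 * (μ ^ 2 * NA) ≤ t ^ 3 * (μ ^ 2 * NA) := mul_le_mul_of_nonneg_right ht23 hμNA0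
  have hn2' : μ ^ 2 * n ^ 2 = μ ^ 2 * NA / 2 := by rw [hnsq]; ring
  have htf : t ^ 2 * f ^ 2 = t ^ 2 * NF := by rw [hfsq]
  have htfa2 : t * (f ^ 2 + μ ^ 2 * a ^ 2) = t * NF + t * (μ ^ 2 * NA) := by rw [hfsq, hasq]; ring
  have hμa : μ ^ 2 * a ^ 2 = μ ^ 2 * NA := by rw [hasq]
  have S3 : NP ≤ 332 * (t ^ 2 * NF) + 84 * (t * (μ ^ 2 * NA)) := by
    rw [← hxsq]
    rw [htf, htfa2, hμa] at hc2sq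
    linarith [S2, hmn, hc2sq, hmsq, hn2', k1, k2, k3]
  -- S4
  have ht3 : 0 ≤ t ^ 3 * NF := by positivity
  calc NW ≤ 10 * t * NP := hpin
    _ ≤ 10 * t * (332 * (t ^ 2 * NF) + 84 * (t * (μ ^ 2 * NA))) := mul_le_mul_of_nonneg_left S3 (by positivity)
    _ = 3320 * (t ^ 3 * NF) + 840 * (t ^ 2 * (μ ^ 2 * NA)) := by ring
    _ ≤ 10 ^ 4 * t ^ 3 * (NF + μ ^ 2 * NA) := by
        have h5 : 0 ≤ t ^ 3 * (μ ^ 2 * NA) := mul_nonneg (pow_nonneg ht0 3) hμNA0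
        have e : (10:ℝ) ^ 4 * t ^ 3 * (NF + μ ^ 2 * NA) = 10 ^ 4 * (t ^ 3 * NF) + 10 ^ 4 * (t ^ 3 * (μ ^ 2 * NA)) := by
          ring
        rw [e]; linarith [k4, ht3, h5]
    _ = 10 ^ 4 / β ^ 3 * (NF + μ ^ 2 * NA) := by rw [e104]

set_option maxHeartbeats 3200000 in
/-- **S2b (the one-variable Volterra–Hardy bound; the new estimate of this line) — PROVED below, `K = 10⁴`.** If `W ∈ C¹[0,b]`
(`b ≥ 4`) with `W(b) = W'(b) = 0`, zero mass `∫₀ᵇ W r dr = 0`, and the flux with strain source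
`J = r W' + (r²/2) W + μ r² A` (`A` continuous, `A(b) = 0`) satisfies `J' = r F`, then for `0 < β ≤ 1`
`∫₀ᵇ e^{βr²/4} W² r dr ≤ (K/β³) (∫₀ᵇ e^{βr²/4} F² r dr + μ² ∫₀ᵇ e^{βr²/4} A² r dr)` with an absolute `K` (`10⁴` will do).
Route (energy form, see `Lines/even-volterra.md` appendix): `P := W − W(0)e^{-r²/4}` has `P(0) = 0` and
`P' + (r/2)P = J/r − μ r A` on `(0,b]`; `ode_weighted_energy_le` (above, sorry-free) gives
`(2−β)/4 ‖P‖²_β ≤ ∫₀ᵇ e^{βr²/4} P (J/r − μ r A) dr ≤ (4/β)‖P‖_β‖F‖_β + |μ| ‖P‖_β ‖A‖_β + O(‖F‖² + |μ|‖A‖‖F‖)` — the strain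
term needs NO weight on `A` because the coercive term carries the factor `r` (this is the Volterra gain; kernel form:
Schur constant `1/(4γ²) ≤ 16`, `γ = (2−β)/8`); the `F`-term uses the landed `radial_hardy_flux` / `radial_flux_sq_le`
(RadialBlockToolsA) on `[1,b]` and the sup bound `|P(r)| ≤ e^{1/4}∫₀ʳ|q|` (`volterra_center_abs_le`, above, sorry-free) on `[0,1]`;
mass zero pins the homogeneous mode: `‖W‖²_β ≤ (10/β)‖P‖²_β` (`radial_mass_pinning`, above, sorry-free). NOT in print in this form (Maekawa 2009 §4 inverts the
radial block through `(−L)^{-1/2}` and the symmetrizer). [folklore] -/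
theorem volterraProfileBound :
    ∃ K : ℝ, 0 ≤ K ∧ ∀ β : ℝ, 0 < β → β ≤ 1 → ∀ (μ b : ℝ), 4 ≤ b →
    ∀ (W W₁ A F J : ℝ → ℝ), (∀ r, HasDerivAt W (W₁ r) r) → Continuous W₁ → Continuous A → Continuous F →
    (∀ r, J r = r * W₁ r + r ^ 2 / 2 * W r + μ * (r ^ 2 * A r)) →
    (∀ r ∈ Set.Icc 0 b, HasDerivAt J (r * F r) r) → W b = 0 → W₁ b = 0 → A b = 0 →
    (∫ r in (0:ℝ)..b, W r * r = 0) →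
    ∫ r in (0:ℝ)..b, Real.exp (β / 4 * r ^ 2) * W r ^ 2 * r ≤
      K / β ^ 3 * ((∫ r in (0:ℝ)..b, Real.exp (β / 4 * r ^ 2) * F r ^ 2 * r) +
        μ ^ 2 * ∫ r in (0:ℝ)..b, Real.exp (β / 4 * r ^ 2) * A r ^ 2 * r) := by
  refine ⟨10 ^ 4, by norm_num, ?_⟩
  intro β hβ hβ1 μ b hb W W₁ A F J hWd hW₁c hAc hFc hJ hJ' hWb hW₁b hAb hmass
  have hb0 : (0:ℝ) ≤ b := by linarith
  have hb1 : (1:ℝ) ≤ b := by linarith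
  have hWc : Continuous W := continuous_iff_continuousAt.2 fun s => (hWd s).continuousAt
  have hEc : ∀ c : ℝ, Continuous fun r : ℝ => Real.exp (c * r ^ 2) := fun c =>
    Real.continuous_exp.comp (continuous_const.mul (continuous_id.pow 2))
  -- names for the norms
  set NW := ∫ r in (0:ℝ)..b, Real.exp (β / 4 * r ^ 2) * W r ^ 2 * r with hNW
  set NF := ∫ r in (0:ℝ)..b, Real.exp (β / 4 * r ^ 2) * F r ^ 2 * r with hNF
  set NA := ∫ r in (0:ℝ)..b, Real.exp (β / 4 * r ^ 2) * A r ^ 2 * r with hNA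
  have hnn : ∀ (G : ℝ → ℝ), 0 ≤ ∫ r in (0:ℝ)..b, Real.exp (β / 4 * r ^ 2) * G r ^ 2 * r := fun G =>
    intervalIntegral.integral_nonneg hb0 fun r hr => by have := hr.1; positivity
  have hNF0 : 0 ≤ NF := hnn F
  have hNA0 : 0 ≤ NA := hnn A
  -- the flux: `J 0 = 0`, `J b = 0`, continuity, Hardy and the pointwise bound
  have hJ0 : J 0 = 0 := by rw [hJ 0]; ring
  have hJb : J b = 0 := by rw [hJ b, hWb, hW₁b, hAb]; ring
  have hJc : Continuous J := by
    have : J = fun r => r * W₁ r + r ^ 2 / 2 * W r + μ * (r ^ 2 * A r) := funext hJ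
    rw [this]; fun_prop
  have hHardy := radial_hardy_flux hβ hb0 hJc hFc hJ' hJ0 hJb
  have hJsq : ∀ r ∈ Icc 0 b, J r ^ 2 ≤ r ^ 2 / 2 * NF := fun r hr => radial_flux_sq_le hβ.le hFc hJ' hJ0 hr
  -- the homogeneous mode and the reconstruction `P`
  set W₀ := W 0 with hW₀
  set P : ℝ → ℝ := fun r => W r - W₀ * Real.exp (-(r ^ 2 / 4)) with hPdef
  set P₁ : ℝ → ℝ := fun r => W₁ r + W₀ * (r / 2 * Real.exp (-(r ^ 2 / 4))) with hP₁def
  set q : ℝ → ℝ := fun r => W₁ r + r / 2 * W r with hqdef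
  have hge : ∀ r, HasDerivAt (fun s => Real.exp (-(s ^ 2 / 4))) (-(r / 2) * Real.exp (-(r ^ 2 / 4))) r := by
    intro r
    have h := hasDerivAt_exp_mul_sq (-(1 / 4)) r
    have e : (fun s => Real.exp (-(1 / 4) * s ^ 2)) = fun s => Real.exp (-(s ^ 2 / 4)) := by
      funext s; congr 1; ring
    rw [e] at h
    refine h.congr_deriv ?_
    have : Real.exp (-(1 / 4) * r ^ 2) = Real.exp (-(r ^ 2 / 4)) := by congr 1; ring
    rw [this]; ring
  have hP : ∀ r, HasDerivAt P (P₁ r) r := by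
    intro r
    have h := (hWd r).sub ((hge r).const_mul W₀)
    refine h.congr_deriv ?_
    simp only [hP₁def]; ring
  have hP₁c : Continuous P₁ := by simp only [hP₁def]; fun_prop
  have hPc : Continuous P := by simp only [hPdef]; fun_prop
  have hqc : Continuous q := by simp only [hqdef]; fun_prop
  have hq : ∀ s, P₁ s + s / 2 * P s = q s := by intro s; simp only [hPdef, hP₁def, hqdef]; ring
  have hP0 : P 0 = 0 := by simp [hPdef, hW₀]
  have hWP : ∀ r, W r = W₀ * Real.exp (-(r ^ 2 / 4)) + P r := by intro r; simp only [hPdef]; ring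
  set NP := ∫ r in (0:ℝ)..b, Real.exp (β / 4 * r ^ 2) * P r ^ 2 * r with hNP
  have hNP0 : 0 ≤ NP := hnn P
  -- (1) pinning: `NW ≤ (10/β) NP`
  have hpin : NW ≤ 10 / β * NP := radial_mass_pinning hβ hβ1 hb hPc hWP hmass
  -- (2) energy: `(2-β)/4 NP ≤ ∫ e P q`
  have henergy : (2 - β) / 4 * NP ≤ ∫ r in (0:ℝ)..b, Real.exp (β / 4 * r ^ 2) * P r * q r := by
    have h := ode_weighted_energy_le (β := β) (b := b) hP hP₁c hP0
    have e : ∫ r in (0:ℝ)..b, Real.exp (β / 4 * r ^ 2) * P r * (P₁ r + r / 2 * P r) =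
        ∫ r in (0:ℝ)..b, Real.exp (β / 4 * r ^ 2) * P r * q r := by
      refine intervalIntegral.integral_congr fun r _ => ?_
      simp only [hq r]
    rw [e] at h
    exact h
  -- (3) the source pairing: `r q = J - μ r² A`
  have hrq : ∀ r, r * q r = J r - μ * (r ^ 2 * A r) := by intro r; simp only [hqdef]; rw [hJ r]; ring
  -- pointwise bound `|q r + μ r A r| ≤ √(NF/2)` on `(0,b]`
  set m : ℝ := Real.sqrt (NF / 2) with hm
  have hm0 : 0 ≤ m := Real.sqrt_nonneg _
  have hmsq : m ^ 2 = NF / 2 := Real.sq_sqrt (by positivity)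
  have hqA : ∀ r ∈ Ioc 0 b, |q r + μ * (r * A r)| ≤ m := by
    intro r hr
    have hr0 : 0 < r := hr.1
    have h1 : (r * (q r + μ * (r * A r))) ^ 2 ≤ r ^ 2 / 2 * NF := by
      have : r * (q r + μ * (r * A r)) = J r := by rw [mul_add, hrq r]; ring
      rw [this]; exact hJsq r ⟨hr0.le, hr.2⟩
    have h2 : (q r + μ * (r * A r)) ^ 2 ≤ m ^ 2 := by
      rw [hmsq]
      have hr2 : 0 < r ^ 2 := by positivity
      rw [mul_pow] at h1
      exact le_of_mul_le_mul_left (by linarith : r ^ 2 * (q r + μ * (r * A r)) ^ 2 ≤ r ^ 2 * (NF / 2)) hr2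
    exact abs_le_of_sq_le_sq' h2 hm0 |> fun h => abs_le.2 h
  -- the source `g := q + μ r A` (continuous, `|g| ≤ m` on `(0,b]`, `r g = J`)
  set g : ℝ → ℝ := fun r => q r + μ * (r * A r) with hgdef
  have hgc : Continuous g := by simp only [hgdef]; fun_prop
  have hgb : ∀ r ∈ Ioc 0 b, |g r| ≤ m := hqA
  have hrg : ∀ r, r * g r = J r := by intro r; simp only [hgdef]; rw [mul_add, hrq r]; ring
  -- split `∫ e P q = I1 - μ I2`
  set I1 := ∫ r in (0:ℝ)..b, Real.exp (β / 4 * r ^ 2) * P r * g r with hI1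
  set I2 := ∫ r in (0:ℝ)..b, Real.exp (β / 4 * r ^ 2) * r * P r * A r with hI2
  have hsplit : ∫ r in (0:ℝ)..b, Real.exp (β / 4 * r ^ 2) * P r * q r = I1 - μ * I2 := by
    rw [hI1, hI2, ← intervalIntegral.integral_const_mul, ← intervalIntegral.integral_sub]
    · refine intervalIntegral.integral_congr fun r _ => ?_
      simp only [hgdef]; ring
    · exact (((hEc _).mul hPc).mul hgc).intervalIntegrable _ _
    · exact (continuous_const.mul ((((hEc _).mul continuous_id).mul hPc).mul hAc)).intervalIntegrable _ _
  -- (3b) `|I2| ≤ √NP √NA`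
  have hw_nonneg : ∀ r ∈ Icc (0:ℝ) b, 0 ≤ Real.exp (β / 4 * r ^ 2) * r := fun r hr => by
    have := hr.1; positivity
  have hwc : Continuous fun r => Real.exp (β / 4 * r ^ 2) * r := (hEc _).mul continuous_id
  have hnorm : ∀ (G : ℝ → ℝ), ∫ r in (0:ℝ)..b, Real.exp (β / 4 * r ^ 2) * r * G r ^ 2 =
      ∫ r in (0:ℝ)..b, Real.exp (β / 4 * r ^ 2) * G r ^ 2 * r := fun G =>
    intervalIntegral.integral_congr fun r _ => by ring
  have hI2 : |I2| ≤ Real.sqrt NP * Real.sqrt NA := by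
    have h := weighted_cs hb0 hw_nonneg hwc hPc hAc
    rw [hnorm P, hnorm A] at h
    rw [← Real.sqrt_mul hNP0]
    exact Real.abs_le_sqrt h
  -- (3c) `I1` on `[1,b]`
  have hPJ : ∫ r in (1:ℝ)..b, Real.exp (β / 4 * r ^ 2) * P r * g r ≤ Real.sqrt NP * (4 / β * Real.sqrt NF) := by
    have step1 : ∫ r in (1:ℝ)..b, Real.exp (β / 4 * r ^ 2) * P r * g r ≤
        ∫ r in (1:ℝ)..b, Real.exp (β / 4 * r ^ 2) * r * |P r| * |J r| := by
      refine intervalIntegral.integral_mono_on hb1 ?_ ?_ fun r hr => ?_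
      · exact (((hEc _).mul hPc).mul hgc).intervalIntegrable _ _
      · exact ((((hEc _).mul continuous_id).mul hPc.abs).mul hJc.abs).intervalIntegrable _ _
      · have hr1 : 1 ≤ r := hr.1
        have hr0 : 0 < r := by linarith
        have hgJ : g r = J r / r := by rw [← hrg r]; field_simp
        have he : 0 ≤ Real.exp (β / 4 * r ^ 2) := (Real.exp_pos _).le
        calc Real.exp (β / 4 * r ^ 2) * P r * g r ≤ |Real.exp (β / 4 * r ^ 2) * P r * g r| := le_abs_self _
          _ = Real.exp (β / 4 * r ^ 2) * |P r| * |J r| / r := by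
              rw [hgJ, abs_mul, abs_mul, abs_div, abs_of_nonneg he, abs_of_pos hr0]; ring
          _ ≤ Real.exp (β / 4 * r ^ 2) * |P r| * |J r| * r := by
              rw [div_le_iff₀ hr0]
              have h0 : 0 ≤ Real.exp (β / 4 * r ^ 2) * |P r| * |J r| := by positivity
              have h1' : 0 ≤ r * r - 1 := by nlinarith
              nlinarith [mul_nonneg h0 h1']
          _ = Real.exp (β / 4 * r ^ 2) * r * |P r| * |J r| := by ring
    have step2 : ∫ r in (1:ℝ)..b, Real.exp (β / 4 * r ^ 2) * r * |P r| * |J r| ≤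
        ∫ r in (0:ℝ)..b, Real.exp (β / 4 * r ^ 2) * r * |P r| * |J r| := by
      refine intervalIntegral.integral_mono_interval zero_le_one hb1 le_rfl ?_ ?_
      · refine MeasureTheory.ae_restrict_of_forall_mem measurableSet_Ioc fun r hr => ?_
        have := hr.1
        positivity
      · exact ((((hEc _).mul continuous_id).mul hPc.abs).mul hJc.abs).intervalIntegrable _ _
    have step3 : (∫ r in (0:ℝ)..b, Real.exp (β / 4 * r ^ 2) * r * |P r| * |J r|) ^ 2 ≤
        NP * ∫ r in (0:ℝ)..b, Real.exp (β / 4 * r ^ 2) * J r ^ 2 * r := by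
      have h := weighted_cs hb0 hw_nonneg hwc hPc.abs hJc.abs
      simp only [sq_abs] at h
      rw [hnorm P, hnorm J] at h
      exact h
    have hNJ : ∫ r in (0:ℝ)..b, Real.exp (β / 4 * r ^ 2) * J r ^ 2 * r ≤ (4 / β) ^ 2 * NF := by
      have : (4 / β) ^ 2 = 16 / β ^ 2 := by ring
      rw [this]; exact hHardy
    have step4 : ∫ r in (0:ℝ)..b, Real.exp (β / 4 * r ^ 2) * r * |P r| * |J r| ≤
        Real.sqrt NP * (4 / β * Real.sqrt NF) := by
      have h1 : (∫ r in (0:ℝ)..b, Real.exp (β / 4 * r ^ 2) * r * |P r| * |J r|) ^ 2 ≤ NP * ((4 / β) ^ 2 * NF) :=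
        step3.trans (mul_le_mul_of_nonneg_left hNJ hNP0)
      have h2 := Real.abs_le_sqrt h1
      rw [Real.sqrt_mul hNP0, Real.sqrt_mul (sq_nonneg _), Real.sqrt_sq (by positivity)] at h2
      exact (le_abs_self _).trans h2
    exact step1.trans (step2.trans step4)
  -- (3d) `I1` on `[0,1]`
  set n : ℝ := Real.sqrt (NA / 2) with hn
  have hn0 : 0 ≤ n := Real.sqrt_nonneg _
  have hnsq : n ^ 2 = NA / 2 := Real.sq_sqrt (by positivity)
  have hA1 : ∫ s in (0:ℝ)..1, s * |A s| ≤ n := by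
    have h := weighted_cs (b := 1) zero_le_one (w := fun s => s) (u := fun _ => (1:ℝ)) (v := fun s => |A s|)
      (fun s hs => hs.1) continuous_id continuous_const hAc.abs
    simp only [mul_one, one_pow, sq_abs] at h
    have hid : ∫ s in (0:ℝ)..1, (s : ℝ) = 1 / 2 := by rw [integral_id]; norm_num
    rw [hid] at h
    have hA2 : ∫ s in (0:ℝ)..1, s * A s ^ 2 ≤ NA := by
      calc ∫ s in (0:ℝ)..1, s * A s ^ 2 ≤ ∫ s in (0:ℝ)..1, Real.exp (β / 4 * s ^ 2) * A s ^ 2 * s := by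
            refine intervalIntegral.integral_mono_on zero_le_one ?_ ?_ fun s hs => ?_
            · exact (continuous_id.mul (hAc.pow 2)).intervalIntegrable _ _
            · exact (((hEc _).mul (hAc.pow 2)).mul continuous_id).intervalIntegrable _ _
            · have hs0 := hs.1
              have he : 1 ≤ Real.exp (β / 4 * s ^ 2) := Real.one_le_exp (by positivity)
              have h0 : 0 ≤ s * A s ^ 2 := by positivity
              nlinarith
        _ ≤ NA := by
            rw [hNA]
            refine intervalIntegral.integral_mono_interval le_rfl zero_le_one hb1 ?_ ?_
            · refine MeasureTheory.ae_restrict_of_forall_mem measurableSet_Ioc fun r hr => ?_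
              have := hr.1
              positivity
            · exact (((hEc _).mul (hAc.pow 2)).mul continuous_id).intervalIntegrable _ _
    have h3 : (∫ s in (0:ℝ)..1, s * |A s|) ^ 2 ≤ n ^ 2 := by rw [hnsq]; nlinarith
    exact (abs_le_of_sq_le_sq' h3 hn0).2
  have hqb : ∀ s ∈ Ioc 0 b, |q s| ≤ m + |μ| * (s * |A s|) := by
    intro s hs
    have hs0 : 0 < s := hs.1
    have e : q s = g s - μ * (s * A s) := by simp only [hgdef]; ring
    rw [e]
    calc |g s - μ * (s * A s)| ≤ |g s| + |μ * (s * A s)| := abs_sub _ _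
      _ ≤ m + |μ| * (s * |A s|) := by
          rw [abs_mul, abs_mul, abs_of_pos hs0]
          linarith [hgb s hs]
  have hintq : ∀ r ∈ Icc (0:ℝ) 1, ∫ s in (0:ℝ)..r, |q s| ≤ m + |μ| * n := by
    intro r hr
    have hr0 : 0 ≤ r := hr.1
    have hr1 : r ≤ 1 := hr.2
    have st1 : ∫ s in (0:ℝ)..r, |q s| ≤ ∫ s in (0:ℝ)..r, (m + |μ| * (s * |A s|)) := by
      refine intervalIntegral.integral_mono_on_of_le_Ioo hr0 ?_ ?_ fun s hs => ?_
      · exact hqc.abs.intervalIntegrable _ _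
      · exact (continuous_const.add (continuous_const.mul (continuous_id.mul hAc.abs))).intervalIntegrable _ _
      · exact hqb s ⟨hs.1, by linarith [hs.2]⟩
    have st2 : ∫ s in (0:ℝ)..r, (m + |μ| * (s * |A s|)) = m * r + |μ| * ∫ s in (0:ℝ)..r, s * |A s| := by
      rw [intervalIntegral.integral_add, intervalIntegral.integral_const, intervalIntegral.integral_const_mul]
      · simp
        ring
      · exact continuous_const.intervalIntegrable _ _
      · exact (continuous_const.mul (continuous_id.mul hAc.abs)).intervalIntegrable _ _
    have st3 : ∫ s in (0:ℝ)..r, s * |A s| ≤ ∫ s in (0:ℝ)..1, s * |A s| := by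
      refine intervalIntegral.integral_mono_interval le_rfl hr0 hr1 ?_ ?_
      · refine MeasureTheory.ae_restrict_of_forall_mem measurableSet_Ioc fun s hs => ?_
        have := hs.1
        positivity
      · exact (continuous_id.mul hAc.abs).intervalIntegrable _ _
    have hmr : m * r ≤ m := by nlinarith
    have habs : 0 ≤ |μ| := abs_nonneg _
    calc ∫ s in (0:ℝ)..r, |q s| ≤ m * r + |μ| * ∫ s in (0:ℝ)..r, s * |A s| := st1.trans st2.le
      _ ≤ m + |μ| * n := by
          have := mul_le_mul_of_nonneg_left (st3.trans hA1) habs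
          linarith
  have hPsup : ∀ r ∈ Icc (0:ℝ) 1, |P r| ≤ Real.exp (1 / 4) * (m + |μ| * n) := by
    intro r hr
    have h := volterra_center_abs_le hP hqc hq hP0 hr
    exact h.trans (mul_le_mul_of_nonneg_left (hintq r hr) (Real.exp_pos _).le)
  set E : ℝ := Real.exp (1 / 4) * Real.exp (1 / 4) with hE
  have hE2 : E ≤ 2 := by
    have e1 : E = Real.exp (1 / 2) := by rw [hE, ← Real.exp_add]; norm_num
    have hsq : Real.exp (1 / 2) ^ 2 = Real.exp 1 := by
      rw [← Real.exp_nat_mul]; norm_num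
    have h9 := Real.exp_one_lt_d9
    have hpos := Real.exp_pos (1 / 2 : ℝ)
    rw [e1]
    nlinarith
  have hE0 : 0 ≤ E := by positivity
  have hP01 : ∫ r in (0:ℝ)..1, Real.exp (β / 4 * r ^ 2) * P r * g r ≤ E * (m + |μ| * n) * m := by
    have step : ∫ r in (0:ℝ)..1, Real.exp (β / 4 * r ^ 2) * P r * g r ≤
        ∫ r in (0:ℝ)..1, E * (m + |μ| * n) * m := by
      refine intervalIntegral.integral_mono_on_of_le_Ioo zero_le_one ?_ ?_ fun r hr => ?_
      · exact (((hEc _).mul hPc).mul hgc).intervalIntegrable _ _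
      · exact continuous_const.intervalIntegrable _ _
      · have hr0 : 0 < r := hr.1
        have hr1 : r < 1 := hr.2
        have he' : Real.exp (β / 4 * r ^ 2) ≤ Real.exp (1 / 4) := by
          apply Real.exp_le_exp.2
          nlinarith [sq_nonneg r, mul_le_mul hβ1 (show r ^ 2 ≤ 1 by nlinarith) (sq_nonneg r) zero_le_one]
        have hP' := hPsup r ⟨hr0.le, hr1.le⟩
        have hg' := hgb r ⟨hr0, by linarith⟩
        calc Real.exp (β / 4 * r ^ 2) * P r * g r ≤ |Real.exp (β / 4 * r ^ 2) * P r * g r| := le_abs_self _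
          _ = Real.exp (β / 4 * r ^ 2) * |P r| * |g r| := by
              rw [abs_mul, abs_mul, abs_of_pos (Real.exp_pos _)]
          _ ≤ Real.exp (1 / 4) * (Real.exp (1 / 4) * (m + |μ| * n)) * m :=
              mul_le_mul (mul_le_mul he' hP' (abs_nonneg _) (Real.exp_pos _).le) hg' (abs_nonneg _)
                (by positivity)
          _ = E * (m + |μ| * n) * m := by simp only [hE]; ring
    rw [intervalIntegral.integral_const] at step
    simpa using step
  -- (3e) assemble the bound on `∫ e P q`
  have hI1split : I1 = (∫ r in (0:ℝ)..1, Real.exp (β / 4 * r ^ 2) * P r * g r) +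
      ∫ r in (1:ℝ)..b, Real.exp (β / 4 * r ^ 2) * P r * g r := by
    rw [hI1, intervalIntegral.integral_add_adjacent_intervals]
    · exact (((hEc _).mul hPc).mul hgc).intervalIntegrable _ _
    · exact (((hEc _).mul hPc).mul hgc).intervalIntegrable _ _
  set x := Real.sqrt NP with hx
  set f := Real.sqrt NF with hf
  set a := Real.sqrt NA with ha
  have hx0 : 0 ≤ x := Real.sqrt_nonneg _
  have hf0 : 0 ≤ f := Real.sqrt_nonneg _
  have ha0 : 0 ≤ a := Real.sqrt_nonneg _
  have hxsq : x ^ 2 = NP := Real.sq_sqrt hNP0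
  have hfsq : f ^ 2 = NF := Real.sq_sqrt hNF0
  have hasq : a ^ 2 = NA := Real.sq_sqrt hNA0
  have habsμ : 0 ≤ |μ| := abs_nonneg _
  have hmain : (2 - β) / 4 * NP ≤ E * (m + |μ| * n) * m + x * (4 / β * f) + |μ| * (x * a) := by
    have h1 : ∫ r in (0:ℝ)..b, Real.exp (β / 4 * r ^ 2) * P r * q r ≤
        E * (m + |μ| * n) * m + x * (4 / β * f) + |μ| * (x * a) := by
      rw [hsplit, hI1split]
      have hμI : -(μ * I2) ≤ |μ| * (x * a) := by
        calc -(μ * I2) ≤ |μ * I2| := neg_le_abs _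
          _ = |μ| * |I2| := abs_mul _ _
          _ ≤ |μ| * (x * a) := mul_le_mul_of_nonneg_left hI2 habsμ
      linarith [hP01, hPJ, hμI]
    exact henergy.trans h1
  -- (4) the scalar endgame
  exact s2b_algebra hβ hβ1 rfl hx0 hf0 ha0 hm0 hn0 hE0 hE2 hxsq hfsq hasq hmsq hnsq hmain hpin


/-- **The sharpened radial bound** (S2a + S2b): for `λ ∈ [0,1)` there is `C_r` such that for every `α` and every
even `C²_c` mass-zero `w`, `‖w₀‖²_{X_λ} ≤ C_r² (‖T_{λ,α} w‖²_{X_λ} + λ² ‖w − w₀‖²_{X_λ})` — the PLAIN norm of the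
fluctuation, uniformly in `α`. -/
theorem radialVolterra :
    ∀ lam ∈ Set.Ico (0 : ℝ) 1, ∃ C : ℝ, 0 ≤ C ∧ ∀ (α : ℝ) (w w₀ : EuclideanSpace ℝ (Fin 2) → ℝ),
    ContDiff ℝ 2 w → HasCompactSupport w → (∀ x, w (-x) = w x) → ∫ x, w x = 0 →
    (w₀ = fun ξ => (2 * Real.pi)⁻¹ * ∫ t in (0:ℝ)..2 * Real.pi, w (Real.cos t • ξ + Real.sin t • perp ξ)) →
    ∫ x, (gaussWeightLam lam x)⁻¹ * w₀ x ^ 2 ≤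
      C ^ 2 * ((∫ x, (gaussWeightLam lam x)⁻¹ * (strainedVorticityOperator lam w x -
          α * (⟪gaussVortexVelocity x, gradient w x⟫_ℝ +
            ⟪biotSavart2D w x, gradient gaussVortexProfile x⟫_ℝ)) ^ 2) +
        lam ^ 2 * ∫ x, (gaussWeightLam lam x)⁻¹ * (w x - w₀ x) ^ 2) := by
  intro lam hlam
  obtain ⟨K, hK0, hK⟩ := volterraProfileBound
  have hβ : 0 < 1 - lam := by linarith [hlam.2]
  have hβ1 : 1 - lam ≤ 1 := by linarith [hlam.1]
  refine ⟨Real.sqrt (K / (1 - lam) ^ 3), Real.sqrt_nonneg _, ?_⟩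
  intro α w w₀ hw hws heven hmass hw₀
  rw [Real.sq_sqrt (by positivity)]
  obtain ⟨b, W, W₁, A, F, J, hb, hWd, hW₁c, hAc, hFc, hJ, hJ', hWb, hW₁b, hAb, hm, hlinkW, hlinkF, hlinkA⟩ :=
    stub_evenPolarReduction lam hlam α w w₀ hw hws heven hmass hw₀
  have h1 := hK (1 - lam) hβ hβ1 (lam / 4) b hb W W₁ A F J hWd hW₁c hAc hFc hJ hJ' hWb hW₁b hAb hm
  -- abbreviations
  set IW := ∫ r in (0:ℝ)..b, Real.exp ((1 - lam) / 4 * r ^ 2) * W r ^ 2 * r with hIW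
  set IF := ∫ r in (0:ℝ)..b, Real.exp ((1 - lam) / 4 * r ^ 2) * F r ^ 2 * r with hIF
  set IA := ∫ r in (0:ℝ)..b, Real.exp ((1 - lam) / 4 * r ^ 2) * A r ^ 2 * r with hIA
  set Tsq := ∫ x, (gaussWeightLam lam x)⁻¹ * (strainedVorticityOperator lam w x -
          α * (⟪gaussVortexVelocity x, gradient w x⟫_ℝ +
            ⟪biotSavart2D w x, gradient gaussVortexProfile x⟫_ℝ)) ^ 2 with hTsq
  set Ap := ∫ x, (gaussWeightLam lam x)⁻¹ * (w x - w₀ x) ^ 2 with hAp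
  set A₀ := ∫ x, (gaussWeightLam lam x)⁻¹ * w₀ x ^ 2 with hA₀
  -- h1 : IW ≤ K/(1-lam)^3 * (IF + (lam/4)^2 * IA)
  have hc : 0 < 8 * Real.pi ^ 2 / (1 - lam) := by positivity
  have hIF0 : 0 ≤ IF := by
    rw [hIF]
    refine intervalIntegral.integral_nonneg (by linarith) fun r hr => ?_
    exact mul_nonneg (mul_nonneg (Real.exp_pos _).le (sq_nonneg _)) hr.1
  have hIA0 : 0 ≤ IA := by
    rw [hIA]
    refine intervalIntegral.integral_nonneg (by linarith) fun r hr => ?_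
    exact mul_nonneg (mul_nonneg (Real.exp_pos _).le (sq_nonneg _)) hr.1
  have hKb : 0 ≤ K / (1 - lam) ^ 3 := by positivity
  -- 8π²/(1-λ) IF ≤ Tsq and 8π²/(1-λ) IA ≤ 2 Ap
  have hF' : 8 * Real.pi ^ 2 / (1 - lam) * IF ≤ Tsq := hlinkF
  have hA' : 8 * Real.pi ^ 2 / (1 - lam) * IA ≤ 2 * Ap := by
    have := hlinkA
    have e : 8 * Real.pi ^ 2 / (1 - lam) * IA = 2 * (4 * Real.pi ^ 2 / (1 - lam) * IA) := by ring
    rw [e]; linarith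
  have hlam2 : (lam / 4) ^ 2 * 2 ≤ lam ^ 2 := by nlinarith [sq_nonneg lam]
  calc A₀ ≤ 8 * Real.pi ^ 2 / (1 - lam) * IW := hlinkW
    _ ≤ 8 * Real.pi ^ 2 / (1 - lam) * (K / (1 - lam) ^ 3 * (IF + (lam / 4) ^ 2 * IA)) :=
        mul_le_mul_of_nonneg_left h1 hc.le
    _ = K / (1 - lam) ^ 3 * ((8 * Real.pi ^ 2 / (1 - lam) * IF) +
          (lam / 4) ^ 2 * (8 * Real.pi ^ 2 / (1 - lam) * IA)) := by ring
    _ ≤ K / (1 - lam) ^ 3 * (Tsq + lam ^ 2 * Ap) := by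
        apply mul_le_mul_of_nonneg_left _ hKb
        have hAp0 : 0 ≤ Ap := integral_inv_gaussWeightLam_mul_sq_nonneg hlam.2 _
        nlinarith [mul_le_mul_of_nonneg_left hA' (sq_nonneg (lam / 4)), sq_nonneg (lam / 4)]


/-- The real-number endgame of `evenBound_of_stubs` (kept free of integrals so that `linarith` stays cheap). [folklore] -/
theorem even_real_algebra {M D Cr C₁ CV lam A A₀ Ap V V' Vfull Tsq Lsq Hsq : ℝ}
    (hM : M = 2 * (3 + Cr ^ 2 + (2 * C₁ ^ 2 + Cr ^ 2) * CV ^ 2))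
    (hD : D = 1 + Cr ^ 2 * (1 + CV ^ 2) + CV ^ 2)
    (hl0 : 0 ≤ lam) (hl1 : lam < 1)
    (hatt : V' ≤ M⁻¹ ^ 2 * (Hsq + Vfull)) (hV' : V' = V)
    (hmink : Real.sqrt Hsq ≤ Real.sqrt Tsq + Real.sqrt Lsq)
    (hLu : Lsq ≤ C₁ ^ 2 * Ap) (hbelow : Ap ≤ CV ^ 2 * V) (hrad : A₀ ≤ Cr ^ 2 * (Tsq + lam ^ 2 * Ap))
    (hVf : Vfull = A₀ + V) (hAsplit : A = A₀ + Ap)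
    (hA₀0 : 0 ≤ A₀) (hAp0 : 0 ≤ Ap) (hV0 : 0 ≤ V) (hT0 : 0 ≤ Tsq) (hL0 : 0 ≤ Lsq) (hH0 : 0 ≤ Hsq) :
    D⁻¹ ^ 2 * A ≤ Tsq := by
  subst hV'
  have hMge : 6 ≤ M := by
    have : 0 ≤ Cr ^ 2 + (2 * C₁ ^ 2 + Cr ^ 2) * CV ^ 2 := by positivity
    linarith
  have hMpos : 0 < M := by linarith
  have hD1 : 1 ≤ D := by
    have : 0 ≤ Cr ^ 2 * (1 + CV ^ 2) + CV ^ 2 := by positivity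
    linarith
  have hDpos : 0 < D := by linarith
  -- Minkowski squared: `Hsq ≤ 2 Tsq + 2 Lsq`
  have hHle : Hsq ≤ 2 * Tsq + 2 * Lsq := by
    have hsq : Real.sqrt Hsq ^ 2 ≤ (Real.sqrt Tsq + Real.sqrt Lsq) ^ 2 :=
      pow_le_pow_left₀ (Real.sqrt_nonneg _) hmink 2
    rw [Real.sq_sqrt hH0] at hsq
    have hsT := Real.sq_sqrt hT0
    have hsL := Real.sq_sqrt hL0
    nlinarith [sq_nonneg (Real.sqrt Tsq - Real.sqrt Lsq), hsq, hsT, hsL]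
  -- drop `λ² ≤ 1`
  have hA₀' : A₀ ≤ Cr ^ 2 * Tsq + Cr ^ 2 * Ap := by
    have hl2 : lam ^ 2 ≤ 1 := pow_le_one₀ hl0 hl1.le
    have hx : 0 ≤ Cr ^ 2 * ((1 - lam ^ 2) * Ap) :=
      mul_nonneg (sq_nonneg _) (mul_nonneg (by linarith) hAp0)
    have e : Cr ^ 2 * (Tsq + lam ^ 2 * Ap) = Cr ^ 2 * Tsq + Cr ^ 2 * Ap - Cr ^ 2 * ((1 - lam ^ 2) * Ap) := by
      ring
    linarith [hrad, hx, e]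
  -- Step 1: `V ≤ Tsq`
  have hMV : M ^ 2 * V' ≤ Hsq + (A₀ + V') := by
    have hMne : M ≠ 0 := hMpos.ne'
    have h := mul_le_mul_of_nonneg_left hatt (sq_nonneg M)
    rw [hVf] at h
    have e : M ^ 2 * (M⁻¹ ^ 2 * (Hsq + (A₀ + V'))) = Hsq + (A₀ + V') := by
      field_simp
    linarith [e]
  have hApV' : (2 * C₁ ^ 2 + Cr ^ 2) * Ap ≤ (2 * C₁ ^ 2 + Cr ^ 2) * (CV ^ 2 * V') :=
    mul_le_mul_of_nonneg_left hbelow (by positivity)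
  have hMV2 : M ^ 2 * V' ≤ (2 + Cr ^ 2) * Tsq + ((2 * C₁ ^ 2 + Cr ^ 2) * CV ^ 2 + 1) * V' := by
    linarith [hMV, hHle, hLu, hA₀', hApV']
  have hMM : M * V' ≤ M ^ 2 * V' := by
    have h : 0 ≤ M * (M - 1) * V' := mul_nonneg (mul_nonneg hMpos.le (by linarith)) hV0
    calc M * V' ≤ M * V' + M * (M - 1) * V' := le_add_of_nonneg_right h
      _ = M ^ 2 * V' := by ring
  have hVT : (2 + Cr ^ 2) * V' ≤ (2 + Cr ^ 2) * Tsq := by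
    have h := hMM.trans hMV2
    rw [hM] at h
    have n1 : 0 ≤ Cr ^ 2 * V' := mul_nonneg (sq_nonneg _) hV0
    have n2 : 0 ≤ C₁ ^ 2 * CV ^ 2 * V' := mul_nonneg (mul_nonneg (sq_nonneg _) (sq_nonneg _)) hV0
    have n3 : 0 ≤ Cr ^ 2 * CV ^ 2 * V' := mul_nonneg (mul_nonneg (sq_nonneg _) (sq_nonneg _)) hV0
    linarith
  have hVT' : V' ≤ Tsq := le_of_mul_le_mul_left hVT (by positivity)
  -- Step 2: `A ≤ D Tsq`
  have hAD : A ≤ D * Tsq := by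
    have h1 : Ap ≤ CV ^ 2 * Tsq := hbelow.trans (mul_le_mul_of_nonneg_left hVT' (sq_nonneg _))
    have h2 : Cr ^ 2 * Ap ≤ Cr ^ 2 * (CV ^ 2 * Tsq) := mul_le_mul_of_nonneg_left h1 (sq_nonneg Cr)
    rw [hAsplit, hD]
    linarith [hA₀', h1, h2, hT0]
  -- Step 3: `c = D⁻¹`
  have hDne : D ≠ 0 := hDpos.ne'
  calc D⁻¹ ^ 2 * A ≤ D⁻¹ ^ 2 * (D * Tsq) := mul_le_mul_of_nonneg_left hAD (sq_nonneg _)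
    _ = D⁻¹ * Tsq := by field_simp
    _ ≤ 1 * Tsq := mul_le_mul_of_nonneg_right (inv_le_one_of_one_le₀ hD1) hT0
    _ = Tsq := one_mul _

set_option maxHeartbeats 1600000 in
/-- **The even sector from the three stubs and the landed chain-B blocks** (`stub_evenSymmetrizerBounds` p169564,
`stub_evenSymmetrizerBoundedBelow` p169885, `stub_evenFluctuationAttenuation`, `stub_coreBoundLamZero` p159715):
for `λ ∈ [0,1)` there are `R₀` and `c > 0` with `c² ‖w‖²_{X_λ} ≤ ‖T_{λ,R} w‖²_{X_λ}` for `R ≥ R₀` and every even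
`C²_c` mass-zero `w`.  `λ = 0`: Gallay–Wayne (`c = 1/2`, every `R`).  `λ ∈ (0,1)`: with `v = w + u`,
`u = Φ·N∗(w − w₀)`, `V = ‖w − w₀ + u‖²`: `V ≤ M⁻²(‖Hv‖² + ‖w₀‖² + V)` (P1 + orthogonality), `‖Hv‖² ≤ 2‖Tw‖² + 2C₁²‖w−w₀‖²`
(identity `Hv = Tw + L_λu` + B1), `‖w − w₀‖² ≤ C_V² V` (B2), `‖w₀‖² ≤ C_r²(‖Tw‖² + λ²‖w − w₀‖²)` (`radialVolterra`);
`M = 2(3 + C_r² + (2C₁² + C_r²)C_V²)` gives `V ≤ ‖Tw‖²`, whence `‖w‖² ≤ D ‖Tw‖²`, `D = 1 + C_r²(1 + C_V²) + C_V²`, `c = D⁻¹`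
(`even_real_algebra`). -/
theorem evenBound_of_stubs :
    ∀ lam ∈ Set.Ico (0 : ℝ) 1, ∃ R₀ c : ℝ, 0 < c ∧ ∀ R : ℝ, R₀ ≤ R →
    ∀ w : EuclideanSpace ℝ (Fin 2) → ℝ, ContDiff ℝ 2 w → HasCompactSupport w →
    (∀ x, w (-x) = w x) → ∫ x, w x = 0 →
    c ^ 2 * ∫ x, (gaussWeightLam lam x)⁻¹ * w x ^ 2 ≤
      ∫ x, (gaussWeightLam lam x)⁻¹ * (strainedVorticityOperator lam w x -
        R * (⟪gaussVortexVelocity x, gradient w x⟫_ℝ +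
          ⟪biotSavart2D w x, gradient gaussVortexProfile x⟫_ℝ)) ^ 2 := by
  intro lam hlam
  have hlam1 : lam < 1 := hlam.2
  rcases eq_or_lt_of_le hlam.1 with h0 | hpos
  · -- `λ = 0`: Gallay–Wayne, every `R` (landed `stub_coreBoundLamZero`)
    subst h0
    refine ⟨0, 1 / 2, by norm_num, fun R _ w hw hws _ hm => ?_⟩
    have hz := stub_coreBoundLamZero R w hw hws hm
    have e : ((1 : ℝ) / 2) ^ 2 = 1 / 4 := by norm_num
    rw [e]
    exact hz
  · have hlamo : lam ∈ Set.Ioo (0 : ℝ) 1 := ⟨hpos, hlam1⟩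
    obtain ⟨C₁, hC₁, hB1⟩ := stub_evenSymmetrizerBounds lam hlamo
    obtain ⟨CV, hCV, hB2⟩ := stub_evenSymmetrizerBoundedBelow lam hlamo
    obtain ⟨Cr, hCr, hS2⟩ := radialVolterra lam hlam
    obtain ⟨M, hM⟩ : ∃ M : ℝ, M = 2 * (3 + Cr ^ 2 + (2 * C₁ ^ 2 + Cr ^ 2) * CV ^ 2) := ⟨_, rfl⟩
    have hMpos : 0 < M := by
      have : 0 ≤ Cr ^ 2 + (2 * C₁ ^ 2 + Cr ^ 2) * CV ^ 2 := by positivity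
      linarith
    obtain ⟨R₀, hP1⟩ := stub_evenFluctuationAttenuation lam hlamo M⁻¹ (inv_pos.2 hMpos)
    obtain ⟨D, hD⟩ : ∃ D : ℝ, D = 1 + Cr ^ 2 * (1 + CV ^ 2) + CV ^ 2 := ⟨_, rfl⟩
    have hDpos : 0 < D := by
      have : 0 ≤ Cr ^ 2 * (1 + CV ^ 2) + CV ^ 2 := by positivity
      linarith
    refine ⟨R₀, D⁻¹, inv_pos.2 hDpos, fun R hR w hw hws heven hmass => ?_⟩
    -- the circular-mean split `w = w₀ + (w - w₀)` (stub S1)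
    obtain ⟨w₀, hw₀def⟩ : ∃ w₀ : EuclideanSpace ℝ (Fin 2) → ℝ, w₀ = fun ξ => (2 * Real.pi)⁻¹ *
        ∫ t in (0:ℝ)..2 * Real.pi, w (Real.cos t • ξ + Real.sin t • perp ξ) := ⟨_, rfl⟩
    obtain ⟨⟨hw₀C2, hw₀s, hw₀rad, hw₀mass⟩, ⟨hwps, hwpeven, hwpcirc⟩, hclassAdd, haver, horth, hHsplit,
      hTsplit⟩ := stub_evenRadialSplit w w₀ hw hws heven hw₀def
    have hwpC2 : ContDiff ℝ 2 (fun x => w x - w₀ x) := hw.sub hw₀C2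
    -- the symmetrizer of the fluctuation (chain B, blocks B1/B2)
    obtain ⟨ψ, hψ⟩ : ∃ ψ : EuclideanSpace ℝ (Fin 2) → ℝ,
        ∀ x, ψ x = ∫ y, (2 * Real.pi)⁻¹ * Real.log ‖x - y‖ * (w y - w₀ y) := ⟨_, fun x => rfl⟩
    obtain ⟨u, hu⟩ : ∃ u : EuclideanSpace ℝ (Fin 2) → ℝ, ∀ x, u x = kerWeight ‖x‖ * ψ x :=
      ⟨_, fun x => rfl⟩
    obtain ⟨huC2, hueven, hucirc, hclass, hident, hIwp, hITwp, hIv, hILu, hIH, hcLu, hcH, hLu, -, -⟩ :=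
      hB1 (fun x => w x - w₀ x) ψ u hwpC2 hwps hwpeven hwpcirc hψ hu
    have hbelow := hB2 (fun x => w x - w₀ x) ψ u hwpC2 hwps hwpeven hwpcirc hψ hu
    -- the sharpened radial bound (stubs S2a + S2b)
    have hrad := hS2 R w w₀ hw hws heven hmass hw₀def
    -- the fluctuation attenuation (P1) on `v = w + u`, `v₀ = w₀`
    have huc : Continuous u := huC2.continuous
    have hv₀ := haver u huc hucirc
    have hg3 : ContDiff ℝ 2 (fun y => w y - w₀ y + u y) := hwpC2.add huC2
    obtain ⟨C', N', hclass'⟩ := hclassAdd (fun y => w y - w₀ y + u y) hg3 hclass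
    have e3 : (fun y => w₀ y + (w y - w₀ y + u y)) = fun y => w y + u y := by funext y; ring
    rw [e3] at hclass'
    have hatt := hP1 R hR (fun y => w y + u y) w₀ (hw.add huC2) hv₀.symm ⟨C', N', hclass'⟩
    have hV' : ∫ x, (gaussWeightLam lam x)⁻¹ * (w x + u x - w₀ x) ^ 2 =
        ∫ x, (gaussWeightLam lam x)⁻¹ * (w x - w₀ x + u x) ^ 2 := by
      congr 1; funext x; ring
    -- orthogonality of the radial part
    obtain ⟨hIw₀, hIwp', hsplitA, horthg⟩ := horth lam hlam1
    have hVsplit := horthg u huc hucirc hIv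
    -- the pointwise identity `H v = T w + L_λ u`
    have hidv : ∀ x, strainedVorticityOperator lam (fun y => w y + u y) x -
        R * ⟪gaussVortexVelocity x, gradient (fun y => w y + u y) x⟫_ℝ =
        (strainedVorticityOperator lam w x -
          R * (⟪gaussVortexVelocity x, gradient w x⟫_ℝ +
            ⟪biotSavart2D w x, gradient gaussVortexProfile x⟫_ℝ)) +
          strainedVorticityOperator lam u x := by
      intro x
      have e : (fun y => w y + u y) = fun y => w₀ y + (w y - w₀ y + u y) := by funext y; ring
      have h1 := hHsplit (fun y => w y - w₀ y + u y) hg3 lam R x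
      have h2 := hTsplit lam R x
      have h3 := hident R x
      rw [e, h1]
      linarith
    -- Minkowski: `√Hsq ≤ √Tsq + √Lsq`
    have hmink : Real.sqrt (∫ x, (gaussWeightLam lam x)⁻¹ *
          (strainedVorticityOperator lam (fun y => w y + u y) x -
            R * ⟪gaussVortexVelocity x, gradient (fun y => w y + u y) x⟫_ℝ) ^ 2) ≤
        Real.sqrt (∫ x, (gaussWeightLam lam x)⁻¹ * (strainedVorticityOperator lam w x -
          R * (⟪gaussVortexVelocity x, gradient w x⟫_ℝ +
            ⟪biotSavart2D w x, gradient gaussVortexProfile x⟫_ℝ)) ^ 2) +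
        Real.sqrt (∫ x, (gaussWeightLam lam x)⁻¹ * (strainedVorticityOperator lam u x) ^ 2) := by
      have key := sqrt_integral_weight_mul_add_sq_le
        (fun x => (inv_nonneg.2 (gaussWeightLam_pos hlam1 x).le))
        (continuous_inv_gaussWeightLam hlam1).aestronglyMeasurable
        (parity_aestronglyMeasurable_coreOp lam R hw) hcLu.aestronglyMeasurable
        (parity_integrable_weight_mul_coreOp_sq hlam R hw hws) hILu
      have e : (fun x => (gaussWeightLam lam x)⁻¹ * (strainedVorticityOperator lam w x -
          R * (⟪gaussVortexVelocity x, gradient w x⟫_ℝ +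
            ⟪biotSavart2D w x, gradient gaussVortexProfile x⟫_ℝ) +
          strainedVorticityOperator lam u x) ^ 2) =
          fun x => (gaussWeightLam lam x)⁻¹ * (strainedVorticityOperator lam (fun y => w y + u y) x -
            R * ⟪gaussVortexVelocity x, gradient (fun y => w y + u y) x⟫_ℝ) ^ 2 := by
        funext x; rw [hidv x]
      rw [e] at key
      exact key
    -- the real-number endgame
    exact even_real_algebra hM hD hlam.1 hlam1 hatt hV' hmink hLu hbelow hrad hVsplit hsplitA
      (integral_inv_gaussWeightLam_mul_sq_nonneg hlam1 _) (integral_inv_gaussWeightLam_mul_sq_nonneg hlam1 _)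
      (integral_inv_gaussWeightLam_mul_sq_nonneg hlam1 _) (integral_inv_gaussWeightLam_mul_sq_nonneg hlam1 _)
      (integral_inv_gaussWeightLam_mul_sq_nonneg hlam1 _) (integral_inv_gaussWeightLam_mul_sq_nonneg hlam1 _)

set_option maxHeartbeats 800000 in
/-- **Composition: the crux `CoreLinearInvertibility` BY NAME** from the three stubs of this line (through
`evenBound_of_stubs`) and the landed rest of the live skeleton — class closure (`stub_gradientInClass` p161986,
`stub_classClosure` p161877), parity split (`stub_parityTools` p160591), `λ = 0` (`stub_coreBoundLamZero` p159715)
and the odd sector (`coreBoundOdd_of_symmetrizer` of `…ModuloMaekawa.lean`: p167124, p167244, p168798, p171406).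
The body is the lead's composition `coreLinearInvertibility_of_maekawa` (line `Sketch`, lead 0) with the Maekawa
hypothesis replaced by `evenBound_of_stubs`; copied with attribution, unchanged otherwise. -/
theorem CoreLinearInvertibility_of :
    Summit.NavierStokesRegularity.NavierStokesRegularity.Theses.FilamentSkeletonRss.CoreLinearInvertibility := by
  intro lam hlam
  have hlam1 : lam < 1 := hlam.2
  obtain ⟨R₀e, ce, hce, hE⟩ := evenBound_of_stubs lam hlam
  have hlam' : (if lam = 0 then (1 / 2 : ℝ) else lam) ∈ Set.Ioo (0 : ℝ) 1 := by
    split_ifs with h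
    · constructor <;> norm_num
    · exact ⟨lt_of_le_of_ne hlam.1 (Ne.symm h), hlam.2⟩
  obtain ⟨R₀o, co, hco, hO⟩ := coreBoundOdd_of_symmetrizer _ hlam'
  refine ⟨max R₀e R₀o, min (min ce co) (1 / 2), lt_min (lt_min hce hco) (by norm_num), ?_⟩
  intro R hR w hw hwX hBS hTX hm0 hm1 hm2
  have hc0 : 0 ≤ min (min ce co) (1 / 2) := (lt_min (lt_min hce hco) (by norm_num)).le
  have hmin_e : (min (min ce co) (1 / 2)) ^ 2 ≤ ce ^ 2 :=
    pow_le_pow_left₀ hc0 ((min_le_left _ _).trans (min_le_left _ _)) 2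
  have hmin_o : (min (min ce co) (1 / 2)) ^ 2 ≤ co ^ 2 :=
    pow_le_pow_left₀ hc0 ((min_le_left _ _).trans (min_le_right _ _)) 2
  have hmin_z : (min (min ce co) (1 / 2)) ^ 2 ≤ (1 / 2) ^ 2 :=
    pow_le_pow_left₀ hc0 (min_le_right _ _) 2
  -- the a-priori bound on C²_c zero-moment vorticities, constant `min (min ce co) (1/2)`
  have hcore : ∀ v : EuclideanSpace ℝ (Fin 2) → ℝ, ContDiff ℝ 2 v → HasCompactSupport v →
      ∫ x, v x = 0 → ∫ x, x 0 * v x = 0 → ∫ x, x 1 * v x = 0 →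
      (min (min ce co) (1 / 2)) ^ 2 * ∫ x, (gaussWeightLam lam x)⁻¹ * v x ^ 2 ≤
        ∫ x, (gaussWeightLam lam x)⁻¹ * (strainedVorticityOperator lam v x -
          R * (⟪gaussVortexVelocity x, gradient v x⟫_ℝ +
            ⟪biotSavart2D v x, gradient gaussVortexProfile x⟫_ℝ)) ^ 2 := by
    intro v hv hvs hv0 hv1 hv2
    by_cases h0 : lam = 0
    · subst h0
      have hz := stub_coreBoundLamZero R v hv hvs hv0
      have hnn := integral_inv_gaussWeightLam_mul_sq_nonneg hlam1 v
      nlinarith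
    · obtain ⟨hec, hes, hoc, hos, heven, hodd, hme, hm1o, hm2o, hsplit, hsplitT⟩ :=
        stub_parityTools lam hlam R v hv hvs
      have hRe : R₀e ≤ R := (le_max_left _ _).trans hR
      have hRo : R₀o ≤ R := (le_max_right _ _).trans hR
      have he := hE R hRe (fun x => (v x + v (-x)) / 2) hec hes heven (by rw [hme, hv0])
      rw [if_neg h0] at hO
      have ho := hO R hRo (fun x => (v x - v (-x)) / 2) hoc hos hodd (by rw [hm1o, hv1])
        (by rw [hm2o, hv2])
      have hnn_e := integral_inv_gaussWeightLam_mul_sq_nonneg hlam1 (fun x => (v x + v (-x)) / 2)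
      have hnn_o := integral_inv_gaussWeightLam_mul_sq_nonneg hlam1 (fun x => (v x - v (-x)) / 2)
      rw [hsplit, hsplitT]
      nlinarith
  -- closure: pass from the C²_c sequence to `w`
  have hgrad := stub_gradientInClass lam hlam R w hw hwX hBS hTX
  obtain ⟨ws, hws, hlimw, hlimT⟩ := stub_classClosure lam hlam R w hw hwX hBS hTX hgrad hm0 hm1 hm2
  have hk : ∀ k, (min (min ce co) (1 / 2)) ^ 2 * ∫ x, (gaussWeightLam lam x)⁻¹ * ws k x ^ 2 ≤
      ∫ x, (gaussWeightLam lam x)⁻¹ * (strainedVorticityOperator lam (ws k) x -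
        R * (⟪gaussVortexVelocity x, gradient (ws k) x⟫_ℝ +
          ⟪biotSavart2D (ws k) x, gradient gaussVortexProfile x⟫_ℝ)) ^ 2 := fun k =>
    hcore (ws k) (hws k).1 (hws k).2.1 (hws k).2.2.1 (hws k).2.2.2.1 (hws k).2.2.2.2
  exact le_of_tendsto_of_tendsto' (hlimw.const_mul _) hlimT hk

end Summit.NavierStokesRegularity.NavierStokesRegularity.Cruxes.CoreLinearInvertibility.EvenVolterra
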